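import Literature.MathematicalPhysics.QuantumFieldTheory.Balaban1983to89.Node00.Record12BgRowGaugeC1Letters

/-!
# NODE 00 — ROW P11: [15] THEOREM 1 RE-TYPED WITH PRINT'S DATA HYPOTHESIS (7) — the MIXED interface plaquettes `V·V̄·V̄⁻¹·V⁻¹` —
# the (R)-only per-scale named fact for print's sequences and print's data (`VariationalThm1RegSepMixed`), and the row's body PER DATUM from it

Cell `pub-ymgap`, seat `pub-ymgap-node00-def-P11` g2 (R218 ∕ OPS-NOTE-16; director-ym №141 «repair = ONE def-P11 edition, deprecate-and-add»; INTENT-8 INBOX l.17052;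
dag-n07-e g6 LOCATED-MIXED l.16936; dag-n21-c g6 INTENT-1 l.16977).  [15] = [Balaban1985Variational]; [6] = [Balaban1985RegularSpaces]; [III] = [Balaban1988Convergent];
[I] = [Balaban1987RG1].

HONEST FRAMING.  Typing + bookkeeping around ONE NAMED FACT (a `Prop` with print's constants as parameters, NEVER asserted) and one displayed C¹ class clause;
nothing of Bałaban asserted or discharged; K0⁗ NOT closed; counts unmoved (typed 28∕28 · discharged 5∕28); one finite `𝕋⁴` torus family at fixed `ε = L^{−K}`; not
continuum ∕ OS ∕ mass gap ∕ Clay.  Three `def`s (print's (7) field, print's (7) predicate, the named fact), no `instance`, no `sorry`.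

DEPRECATION (recorded here; FILE 2 `Record12BgRowAnalysis` stays byte-identical).  `VariationalThm1Scaled`, `VariationalThm1Class` (FILE 2 §2) and
`VariationalThm1ScaledSep` (§8) carry the DATA clause `∀ n ≤ k, PlaqSmallOn (plaqsOf (genSet s.Ω k n)) (δ n) (W n)` — the scale-`n` datum read on ALL FOUR bonds of every
level-`n` plaquette touching `Γ_n`.  Print's hypothesis (7) [15] p. 278 reads, on the bonds of such a plaquette that do NOT belong to `Λ_n` (both endpoints off `Γ_n`), the
AVERAGED finer datum `V̄` («if ⟨y,z⟩ does not belong to Λ_j then y, z ∈ Λ_{j−1} and we define (∂V)(p′) = V(x,y)V̄(y,z)V(z,w)V(w,x)»); the fibre (`AgreeOn`, `bondsOf` = bonds with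
an endpoint in `Γ_n`) never reads `W n` there.  LOCATED (dag-n07-e g6, kernel certificate `…N07Thm1MixedPlaquetteObstruction`): a cross-scale-incompatible pure-gauge datum
passes the typed clause and has EMPTY fibre ∩ class, so the existence conjunct (E) of all three facts is FALSE for every `B₃`; LOCATED (this seat, INBOX l.17052, sketch):
a SOFT twist passes it with a non-empty fibre and forces curvature `≳ t∕L²` on the minimiser, so the regularity conjunct (R) is plausibly false too, and so is the record's
`Provisos₁₃Sep.bg` over `suppOfRecord₁₃Sep` (same junk freedom in `regSuppOfRecord`).  The three facts are SUPERSEDED by `VariationalThm1RegSepMixed` below: (7)'s data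
clause, (R) only ((E) dropped — every consumer reads `.2`; (E)-as-typed also carries the minimiser-over-(6) vs (8) reading), separated sequences, comparable thresholds.

PRINT ([15] p. 278 L20–33, p. 279 Thm 1).  «we assume that |(∂V)(p′) − 1| < ε₁ for p′ ∈ 𝔅 (7) … For some j between 0 and k p′ ∈ Λ_j. If p′ ⊂ Λ_j, i.e. all four vertices of
p′ belong to Λ_j, then … (∂V)(p′) = V(∂p′). If p′ intersects the boundary of Λ_j then some bonds b do not belong to Λ_j and we replace V_b by V̄_b … if ⟨y,z⟩ does not belong
to Λ_j then it means that y, z ∈ Λ_{j−1} and we define (∂V)(p′) = V(x,y)V̄(y,z)V(z,w)V(w,x).»  Thm 1: «… there exists a minimal orbit in the space U_k({Ω_j}, B₃ε₁) ∩ 𝔘(𝔅_k, V) (8).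
This orbit is a unique critical orbit in the space (6) if B₃ε₁ ≤ ε₀ and ε₀ ≤ a₀.»  READ AT THE RECORD: level 0 — plaquettes with all four vertices in `Γ₀ = (Ω₁)ᶜ` (`plaqInside`),
datum `W 0`; level `m+1 ≤ k` — every plaquette TOUCHING `Γ_{m+1}` (`plaqsOf (genSet s.Ω k (m+1))`), the bonds touching `Γ_{m+1}` carry `W (m+1)`, the others the one-step
average `(av m).avg (W m)` of the finer datum (`Sect2.mixedField`).  (R) = «unique critical orbit in (6)» + Fermat for a minimiser over the `ε₀`-class: every minimiser of (2.12)
over the class `ε₀` with (7)-small data `δ` lies in the class `B₃δ` — per scale (`δ_n`, class `B₃δ_n` at scale `n`), for SEPARATED sequences ([6] (1.3)–(1.6)) and COMPARABLE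
thresholds ([III] (2.7)–(2.8)).  Floor for inhabitation (ref-H READ-82, n21-c p499903): `2L² ≤ B₃` — displayed by consumers.

CONTENTS.  §1 `Sect2.mixedField` (def), `Sect2.mixedField_of_mem`∕`_of_not_mem`, `Sect2.DataSmall7` (def), `Sect2.DataSmall7.zero`∕`.succ`.  §2 ★★ `VariationalThm1RegSepMixed` (def,
the named fact).  §3 ★ `plaqSmallOn_UbgMSOfRecord_of_thm1RegSepMixed` (def-R's background is `B₃·cR·ε_n·η_n²`-regular at every scale for a (7)-regular datum with solvable fibre).  §4
PER-DATUM assembly (FILE 5 v1.2's `bgRowAt_of_classBounds` with the datum fixed — the support no longer enters): `bgRowAtDatum_of_classBounds` (h3 displayed),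
`bgRowAtDatum_of_classBoundsC1` (FILE 7b's C¹ route), ★★★ `bgRowAtDatum_of_thm1RegSepMixedC1` (the row's body at `(s, W)` from the re-typed fact + `h7 : Sect2.DataSmall7 … W` + the C¹
class clause + FILE 7c's numerics letters), `bgRowAtDatum_of_thm1RegSepMixed` (the axial-`h3` twin for node00-def-K0a's 11b shape).

DEPENDENCES (by name): `B15DeterminingSets.(MSField, genSet, bondsOf, AgreeOn, IsMinimizer, avgFamily)`, `Setup.Averaging`, def-R `avOfRecord`, `UbgMSOfRecord`,
`isMinimizer_UbgMSOfRecord`, `regMSOfRecord`, `omegaPlaqs(_of_ne_zero)`, `plaqInside`, `epsOfRecord`, `solvableDom`; FILE 2 `Sect2.SeqSeparated`; FILE 4∕5∕7b∕7c as imported.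
-/

noncomputable section

open MeasureTheory
open scoped Matrix.Norms.L2Operator

namespace Literature.MathematicalPhysics.QuantumFieldTheory.Balaban1983to89.Node00

open T4Continuum B14.Eq218Concrete B15DeterminingSets B12RegularSpaces111 B14RegularSpaces234 B14Radii T4AxialGaugeSmallField

/-! ## §1  Print's (7): the mixed interface plaquettes — the bonds off `Λ_{m+1}` carry the averaged finer datum -/

section Mixed

variable {P : Params} {G : Type*} [GaugeGroup G]

open Classical in
/-- **PRINT'S (7) FIELD AT LEVEL `m+1`**: on the level-`(m+1)` bonds that belong to `Λ_{m+1}` (at least one endpoint in the site set `S` of `Γ_{m+1}`, r12's `bondsOf S`) the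
datum `W_{m+1}`; on the others (both endpoints in the finer region `Λ_m`) print's `V̄` — the one-step average of the finer datum `W_m` («we replace V_b by V̄_b … if ⟨y,z⟩ does not belong
to Λ_j then it means that y, z ∈ Λ_{j−1}»). [cite: Balaban1985Variational, (7) p.278 L26–33] -/
def Sect2.mixedField (av : ∀ j, Averaging P j G) {m : ℕ} (S : Set (Site P (m + 1))) (Wn : GaugeField P (m + 1) G) (Wm : GaugeField P m G) :
    GaugeField P (m + 1) G :=
  fun b => if b ∈ bondsOf S then Wn b else (av m).avg Wm b

/-- On a bond of `Λ_{m+1}` the (7) field is the datum. [cite: Balaban1985Variational, (7) p.278 (bookkeeping)] -/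
theorem Sect2.mixedField_of_mem (av : ∀ j, Averaging P j G) {m : ℕ} {S : Set (Site P (m + 1))} (Wn : GaugeField P (m + 1) G) (Wm : GaugeField P m G)
    {b : PBond P (m + 1)} (hb : b ∈ bondsOf S) : Sect2.mixedField av S Wn Wm b = Wn b := by
  unfold Sect2.mixedField; rw [if_pos hb]

/-- Off `Λ_{m+1}` the (7) field is the averaged finer datum `V̄`. [cite: Balaban1985Variational, (7) p.278 (bookkeeping)] -/
theorem Sect2.mixedField_of_not_mem (av : ∀ j, Averaging P j G) {m : ℕ} {S : Set (Site P (m + 1))} (Wn : GaugeField P (m + 1) G) (Wm : GaugeField P m G)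
    {b : PBond P (m + 1)} (hb : b ∉ bondsOf S) : Sect2.mixedField av S Wn Wm b = (av m).avg Wm b := by
  unfold Sect2.mixedField; rw [if_neg hb]

/-- **PRINT'S DATA HYPOTHESIS (7) AT THE RECORD, per scale** («|(∂V)(p′) − 1| < ε₁ for p′ ∈ 𝔅» with the boundary rule of p. 278, thresholds `δ_n` at scale `n`): level 0 — every
plaquette with all four vertices in `Γ₀` (`plaqInside`; `Γ₀ = genSet Ω k 0`, the complement of `Ω₁`), datum `W 0`; level `m + 1 ≤ k` — every plaquette TOUCHING `Γ_{m+1}`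
(`plaqsOf (genSet Ω k (m+1))`) in the (7) field of `W (m+1)` over the averaged `W m`.  Typed over a concrete r11 (2.18) index `Ω` — print's determining sets are more general.
-- TODO(general form): (7) is stated for an arbitrary admissible sequence of block sets `𝔅 = ∪ Λ_j` of [6] Sect. A; here `𝔅_k = genSet Ω k` of a (2.18) index.
[cite: Balaban1985Variational, (7) p.278 L20–33; Balaban1985RegularSpaces, (1.3)–(1.8) p.77; Balaban1988Convergent, (2.10)–(2.12) p.256] -/
def Sect2.DataSmall7 (av : ∀ j, Averaging P j G) (Ω : ℕ → Set (Site P 0)) (k : ℕ) (δ : ℕ → ℝ) (W : MSField P G) : Prop :=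
  PlaqSmallOn (plaqInside (genSet Ω k 0)) (δ 0) (W 0) ∧
    ∀ m, m + 1 ≤ k → PlaqSmallOn (B8Eq17ClassAkV1.plaqsOf (genSet Ω k (m + 1))) (δ (m + 1)) (Sect2.mixedField av (genSet Ω k (m + 1)) (W (m + 1)) (W m))

/-- The level-0 clause of (7). [cite: Balaban1985Variational, (7) p.278 (bookkeeping)] -/
theorem Sect2.DataSmall7.zero {av : ∀ j, Averaging P j G} {Ω : ℕ → Set (Site P 0)} {k : ℕ} {δ : ℕ → ℝ} {W : MSField P G} (h : Sect2.DataSmall7 av Ω k δ W) :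
    PlaqSmallOn (plaqInside (genSet Ω k 0)) (δ 0) (W 0) := h.1

/-- The level-`(m+1)` clause of (7). [cite: Balaban1985Variational, (7) p.278 (bookkeeping)] -/
theorem Sect2.DataSmall7.succ {av : ∀ j, Averaging P j G} {Ω : ℕ → Set (Site P 0)} {k : ℕ} {δ : ℕ → ℝ} {W : MSField P G} (h : Sect2.DataSmall7 av Ω k δ W)
    {m : ℕ} (hm : m + 1 ≤ k) :
    PlaqSmallOn (B8Eq17ClassAkV1.plaqsOf (genSet Ω k (m + 1))) (δ (m + 1)) (Sect2.mixedField av (genSet Ω k (m + 1)) (W (m + 1)) (W m)) := h.2 m hm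

/-- Weakening the thresholds of (7). [cite: Balaban1985Variational, (7) p.278 (bookkeeping)] -/
theorem Sect2.DataSmall7.of_le {av : ∀ j, Averaging P j G} {Ω : ℕ → Set (Site P 0)} {k : ℕ} {δ δ' : ℕ → ℝ} {W : MSField P G} (h : Sect2.DataSmall7 av Ω k δ W)
    (hδ : ∀ n, n ≤ k → δ n ≤ δ' n) : Sect2.DataSmall7 av Ω k δ' W :=
  ⟨fun p hp => (h.1 p hp).trans_le (hδ 0 (Nat.zero_le _)), fun m hm p hp => (h.2 m hm p hp).trans_le (hδ (m + 1) hm)⟩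

end Mixed

/-! ## §2  ★★ [15] THEOREM 1, sentence 2 (R), per scale, print's sequences, print's data (7) — the NAMED FACT -/

section NamedFact

variable (F : T4Family) (N : ℕ) [NeZero N]

/-- **[15] THEOREM 1 — «the minimal orbit … is the unique critical orbit in the space (6)», READ AS THE REGULARITY OF MINIMISERS, PER SCALE, FOR PRINT'S SEQUENCES AND
PRINT'S DATA (7)** (a NAMED FACT — a `Prop`, NEVER asserted; constants `B₃, a₀, a₁` as parameters, print: «depend on d and L only»).  For a SEPARATED (2.18) index `s`
([6] (1.3)–(1.6), `Sect2.SeqSeparated ν.M₁ s`), data thresholds `0 < δ_n ≤ a₁`, `B₃δ_n ≤ ε₀ ≤ a₀`, COMPARABLE across consecutive scales (`δ_n ≤ 2δ_{n+1}`, [III] (2.7)–(2.8)),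
and a datum `W` satisfying PRINT'S (7) with thresholds `δ_n` — `Sect2.DataSmall7 (avOfRecord F N K) s.Ω k δ W`: level 0 on the plaquettes inside `Γ₀`, level `n ≥ 1` on the
plaquettes touching `Γ_n` in the (7) field (bonds off `Λ_n` carry the AVERAGED finer datum) —, EVERY minimiser `U₀` of (2.12) over the class of threshold `ε₀` on the fibre of
`W` lies in the class of threshold `B₃δ_n` at every scale `n ≤ k`: `|U₀(∂p) − 1| < B₃δ_n·η_n²` on the plaquettes meeting `Ω_n(s)`.  (In print: a minimiser over (6) is a critical
orbit in (6), hence THE critical orbit, which lies in `U_k({Ω_j}, B₃ε₁)` (8).)  The existence sentence of Thm 1 is NOT part of this fact (no consumer needs it; its typed form over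
the class (6) was located false under the same-scale data reading and carries the (6)-vs-(8) minimality reading otherwise).  SUPERSEDES `VariationalThm1Scaled`∕`…Class`∕
`…ScaledSep` (FILE 2), whose same-scale data clause admits print-excluded data (header).
-- TODO(general form): [15] Thm 1 is printed with ONE threshold ε₁ for all scales and for general admissible `{Ω_j}`∕`𝔅_k`; the per-scale∕comparable form is the reading
-- [III] p. 259 invokes («for proper restrictions on ε_j»); the uniform instance is `δ_n := ε₁`.
[cite: Balaban1985Variational, Thm 1 (7)–(8) pp.278–279; Balaban1985RegularSpaces, (1.3)–(1.8) p.77; Balaban1988Convergent, (2.7)–(2.8) pp.255–256, (2.12) p.256, p.259] -/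
def VariationalThm1RegSepMixed (B₃ a₀ a₁ : ℝ) : Prop :=
  ∀ (ν : Stage7Numerics) (M : ℕ) (g : ℕ → ℝ) (K k : ℕ) (s : SeqOfRecord F ν M g K k), Sect2.SeqSeparated ν.M₁ s → ∀ (ε₀ : ℝ) (δ : ℕ → ℝ),
    (∀ n, n ≤ k → 0 < δ n ∧ δ n ≤ a₁ ∧ B₃ * δ n ≤ ε₀) → (∀ n, n < k → δ n ≤ 2 * δ (n + 1)) → ε₀ ≤ a₀ →
    ∀ W : MSField (F.P K) (SU N), Sect2.DataSmall7 (avOfRecord F N K) s.Ω k δ W →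
      ∀ U₀, IsMinimizer (avOfRecord F N K) {U | ∀ n, n ≤ k → PlaqSmallOn (omegaPlaqs s.Ω n) (ε₀ * (F.P K).eta n ^ 2) U} (genSet s.Ω k) W U₀ →
        ∀ n, n ≤ k → PlaqSmallOn (omegaPlaqs s.Ω n) (B₃ * δ n * (F.P K).eta n ^ 2) U₀

end NamedFact

/-! ## §3  The class bound at def-R's background of record, from the re-typed fact, for a (7)-regular datum -/

section ClassBound

variable {F : T4Family} {N : ℕ} [NeZero N]

/-- **★ DEF-R'S BACKGROUND IS `B₃·cR·ε_n`-REGULAR AT EVERY SCALE FOR A (7)-REGULAR DATUM** along a separated sequence with comparable thresholds: if `𝐖` satisfies print's (7)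
with thresholds `cR·ε_n(g_n)` (`h7`), (2.12) is solvable in the class of record for `𝐖` (`hsol`), and the numerics put the record's class between print's two classes
(`0 < cR·ε_n ≤ a₁`, `B₃·cR·ε_n ≤ εreg ≤ a₀`), then `U_k(s)(𝐖)` — a minimiser in the class `εreg` — satisfies `|∂U − 1| < B₃·cR·ε_n·η_n²` on the plaquettes meeting `Ω_n(s)`.
No membership of `𝐖` in def-R's support is used: (7) IS the datum hypothesis. [cite: Balaban1985Variational, Thm 1 (7)–(8) pp.278–279; Balaban1988Convergent, (2.7)–(2.8) pp.255–256, (2.12) p.256, p.259] -/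
theorem plaqSmallOn_UbgMSOfRecord_of_thm1RegSepMixed {B₃ a₀ a₁ : ℝ} (h15 : VariationalThm1RegSepMixed F N B₃ a₀ a₁) (ν : Stage7Numerics) (M : ℕ)
    (g : ℕ → ℝ) (K k : ℕ) (cR : ℝ) (s : SeqOfRecord F ν M g K k) (hsep : Sect2.SeqSeparated ν.M₁ s)
    (hnum : ∀ n, n ≤ k → 0 < cR * epsOfRecord ν g n ∧ cR * epsOfRecord ν g n ≤ a₁ ∧ B₃ * (cR * epsOfRecord ν g n) ≤ ν.εreg) (ha₀ : ν.εreg ≤ a₀)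
    (hcomp : ∀ n, n < k → cR * epsOfRecord ν g n ≤ 2 * (cR * epsOfRecord ν g (n + 1)))
    {W : MSField (F.P K) (SU N)} (h7 : Sect2.DataSmall7 (avOfRecord F N K) s.Ω k (fun n => cR * epsOfRecord ν g n) W)
    (hsol : W ∈ solvableDom (avOfRecord F N K) (regMSOfRecord F N ν K k s.Ω) (genSet s.Ω k)) :
    ∀ n, n ≤ k → PlaqSmallOn (omegaPlaqs s.Ω n) (B₃ * (cR * epsOfRecord ν g n) * (F.P K).eta n ^ 2) (UbgMSOfRecord F N ν M g K k s W) :=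
  h15 ν M g K k s hsep ν.εreg (fun n => cR * epsOfRecord ν g n) hnum hcomp ha₀ W h7 _ (isMinimizer_UbgMSOfRecord ν M g K k s hsol)

end ClassBound

/-! ## §4  The row's body PER DATUM — FILE 5 v1.2's assembly with the datum fixed (the support no longer enters) -/

section Record

variable {F : T4Family} {N : ℕ} [NeZero N]

/-- **THE ROW'S BODY AT ONE SEQUENCE `s` AND ONE DATUM `𝐖`, FROM PER-SCALE CLASS BOUNDS `b_n·η_n²` on def-R's background for THAT datum** (whatever their source) + numerics + (C1)(C2) +
no wrapping + the derivative members of (1.12)∕(2.38) for the axial potentials (`h3I`∕`h3MS`, displayed): FILE 5 v1.2's `bgRowAt_of_classBounds` with the datum FIXED — the class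
bounds are asked only for `𝐖` (when its fibre is solvable), so no support set enters.  Proof = FILE 5's, verbatim per datum. [cite: Balaban1988Convergent, (2.27)–(2.28) p.259, (2.34)–(2.41) p.261; Balaban1987RG1, (1.11)–(1.16) p.262] -/
theorem bgRowAtDatum_of_classBounds (S : Sect2.Setting (MatA N) (SU N)) (hι : S.ι = ιSU N) (h𝓜 : S.𝓜 = B12RegularSpaces111SpecialUnitary.suModel N) (hS : S.Laws)
    (hpos : S.Pos) (ν : Stage7Numerics) {M : ℕ} (hM : 0 < M) (K k : ℕ) {b : ℕ → ℝ} (hb0 : ∀ n, n ≤ k → 0 ≤ b n)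
    (s : SeqOfRecord F ν M S.flow.g K k) (W : MSField (F.P K) (SU N))
    (hclass : W ∈ solvableDom (avOfRecord F N K) (regMSOfRecord F N ν K k s.Ω) (genSet s.Ω k) →
      ∀ n, n ≤ k → PlaqSmallOn (omegaPlaqs s.Ω n) (b n * (F.P K).eta n ^ 2) (UbgMSOfRecord F N ν M S.flow.g K k s W))
    (hα : ∀ n, 1 ≤ n → n ≤ k → 0 < S.lf.alpha0 (S.flow.g n) ∧ 0 < S.lf.alpha1 (S.flow.g n))
    (hbα : ∀ n, 1 ≤ n → n ≤ k → b n ≤ (1 - S.βc) * S.lf.alpha0 (S.flow.g n))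
    (hsN : ∀ n, 1 ≤ n → n ≤ k + 1 → ((B14.Eq213MaximalDomains.side (F.P K).L M n : ℕ) : ℤ) < (F.P K).sitesPerDir 0)
    (hcB : 2 * (((F.P K).d - 1 : ℕ) : ℝ) * ((F.P K).L * M) < S.cB) (hBCM : 2 * (((F.P K).d - 1 : ℕ) : ℝ) * M < S.B * S.C * S.Mr)
    (hsmallI : ∀ j, 1 ≤ j → j ≤ k → (((F.P K).d - 1 : ℕ) : ℝ) * ((F.P K).L * M) * (F.P K).eta j * b j ≤ 1 / 2)
    (hsmallMS : ∀ n, 1 ≤ n → n ≤ k → (((F.P K).d - 1 : ℕ) : ℝ) * M * (F.P K).eta n * b n ≤ 1 / 2)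
    (hC1 : ∀ j, 1 ≤ j → j ≤ k → ∃ t : ℕ, 0 < t ∧ RkOfRecord (F.P K).L ν.r (S.flow.g j) = (F.P K).L * t)
    (hC2 : ∀ j, 1 ≤ j → j ≤ k → dCubeSide (F.P K).L M (RkOfRecord (F.P K).L ν.r (S.flow.g j)) j ∣ (F.P K).sitesPerDir 0)
    (h3I : W ∈ solvableDom (avOfRecord F N K) (regMSOfRecord F N ν K k s.Ω) (genSet s.Ω k) →
      ∀ j, 1 ≤ j → j ≤ k → ∀ X : (Sect2.domSys (F.P K) M j).Dom, Sect2.domSites (F.P K) M j X ⊆ s.Λ j →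
      ∀ a ∈ cubeIndices (F.P K) (B14.Eq213MaximalDomains.side (F.P K).L M (j + 1)),
        (cubeEnl (F.P K) (B14.Eq213MaximalDomains.side (F.P K).L M (j + 1)) a 0 ∩ Sect2.domSites (F.P K) M j X).Nonempty →
        ∀ q ∈ (Sect2.regionOfSet (F.P K) (cubeEnl (F.P K) (B14.Eq213MaximalDomains.side (F.P K).L M (j + 1)) a 0 ∩ Sect2.domSites (F.P K) M j X)).dpairs,
          ‖grad ((F.P K).eta j) q.2.1 (fun y => axialPotential (UbgMSOfRecord F N ν M S.flow.g K k s W)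
            (boxLo (B14.Eq213MaximalDomains.side (F.P K).L M (j + 1)) a) (boxHi (B14.Eq213MaximalDomains.side (F.P K).L M (j + 1)) a) ((F.P K).eta j)
            ⟨y, q.2.2⟩) q.1‖ < S.cB * S.lf.alpha0 (S.flow.g j))
    (h3MS : W ∈ solvableDom (avOfRecord F N K) (regMSOfRecord F N ν K k s.Ω) (genSet s.Ω k) →
      ∀ j, 1 ≤ j → j ≤ k → ∀ X : (Sect2.domSys (F.P K) M j).Dom, ∀ n, 1 ≤ n → n ≤ j →
      ∀ a ∈ cubeIndices (F.P K) (B14.Eq213MaximalDomains.side (F.P K).L M n),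
        (cubeEnl (F.P K) (B14.Eq213MaximalDomains.side (F.P K).L M n) a 0 ∩ Sect2.domSites (F.P K) M j X).Nonempty →
        cubeEnl (F.P K) (B14.Eq213MaximalDomains.side (F.P K).L M n) a 0 ⊆ s.Ω n →
        ∀ q ∈ (Sect2.regionOfSet (F.P K) (cubeEnl (F.P K) (B14.Eq213MaximalDomains.side (F.P K).L M n) a 0 ∩ Sect2.domSites (F.P K) M j X)).dpairs,
          (((F.P K).L : ℝ) ^ n * (F.P K).eta j) ^ 2 * ‖grad ((F.P K).eta j) q.2.1 (fun y => axialPotential (UbgMSOfRecord F N ν M S.flow.g K k s W)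
            (boxLo (B14.Eq213MaximalDomains.side (F.P K).L M n) a) (boxHi (B14.Eq213MaximalDomains.side (F.P K).L M n) a) ((F.P K).eta j) ⟨y, q.2.2⟩) q.1‖ <
            rad238 S.B S.C S.Mr (S.lf.alpha0 (S.flow.g n))) :
    ∀ j, 1 ≤ j → j ≤ k → ∀ X : (Sect2.domSys (F.P K) M j).Dom,
      (Sect2.domSites (F.P K) M j X ⊆ s.Λ j →
        Sect2.ofBackgroundC S.ι (UbgMSOfRecord F N ν M S.flow.g K k s W) ∈
          Sect2.spaceI S (Sect2.Residual.unit (F.P K) (MatA N)) M j (Sect2.domSites (F.P K) M j X) (S.lf.alpha0 (S.flow.g j)) (S.lf.alpha1 (S.flow.g j))) ∧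
      (Sect2.admB (F.P K) ν M S.flow.g s.Ω s.Λ j (Sect2.domSites (F.P K) M j X) = true →
        Sect2.ofBackgroundC S.ι (UbgMSOfRecord F N ν M S.flow.g K k s W) ∈
          Sect2.spaceMS S (Sect2.Residual.unit (F.P K) (MatA N)) M j (Sect2.domSites (F.P K) M j X) s.Ω) := by
  intro j h1 hjk X
  have hd : (0 : ℝ) ≤ (((F.P K).d - 1 : ℕ) : ℝ) := Nat.cast_nonneg _
  have hηj : 0 < (F.P K).eta j := pow_pos (inv_pos.mpr (Nat.cast_pos.mpr (F.P K).L_pos)) j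
  have hbα' : ∀ n, 1 ≤ n → n ≤ k → b n ≤ S.lf.alpha0 (S.flow.g n) := by
    intro n hn1 hnk
    refine (hbα n hn1 hnk).trans ?_
    have h0 := (hα n hn1 hnk).1.le
    nlinarith [hpos.βc_nonneg, h0]
  refine ⟨fun hX => ?_, fun _ => ?_⟩
  · -- the `U^c_j` conjunct: class bound at scale `j`, (1.12)(a)(b) by the axial gauge on the cubes of `X`, (c) displayed
    have hcubeΩ := hcubeΩ_of_compatible (F := F) ν hM S.flow.g K k s hC1 hC2 j h1 hjk X hX
    have hloc : W ∈ solvableDom (avOfRecord F N K) (regMSOfRecord F N ν K k s.Ω) (genSet s.Ω k) →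
        ∀ C ∈ Sect2.cubesI M j (Sect2.domSites (F.P K) M j X), ∃ u : Site (F.P K) 0 → (MatA N)ˣ, (∀ x, u x ∈ S.𝓜.G) ∧ ∃ A : PBond (F.P K) 0 → MatA N,
          (∀ bd ∈ C.bonds, gaugeU u (fun b' => S.ι (UbgMSOfRecord F N ν M S.flow.g K k s W b')) bd = expI ((F.P K).eta j) (A bd)) ∧
          (∀ bd ∈ C.bonds, ‖A bd‖ < S.cB * S.lf.alpha0 (S.flow.g j)) ∧
          ∀ q ∈ C.dpairs, ‖grad ((F.P K).eta j) q.2.1 (fun y => A ⟨y, q.2.2⟩) q.1‖ < S.cB * S.lf.alpha0 (S.flow.g j) := by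
      intro hsol
      have hclassj : PlaqSmallOn (B8Eq17ClassAkV1.plaqsOf (s.Ω j)) (b j * (F.P K).eta j ^ 2) (UbgMSOfRecord F N ν M S.flow.g K k s W) := by
        have h := hclass hsol j hjk
        rwa [omegaPlaqs_of_ne_zero _ (Nat.one_le_iff_ne_zero.mp h1)] at h
      have hside := side_pred_mul_eta_le (P := F.P K) M j
      have hα0 : 0 < S.lf.alpha0 (S.flow.g j) := (hα j h1 hjk).1
      have hs0 : (0 : ℝ) ≤ ((B14.Eq213MaximalDomains.side (F.P K).L M (j + 1) - 1 : ℕ) : ℝ) := Nat.cast_nonneg _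
      have hbj0 := hb0 j hjk
      have hsmall : (((F.P K).d - 1 : ℕ) : ℝ) * ((B14.Eq213MaximalDomains.side (F.P K).L M (j + 1) - 1 : ℕ) : ℝ) * (b j * (F.P K).eta j ^ 2) ≤ 1 / 2 := by
        calc (((F.P K).d - 1 : ℕ) : ℝ) * ((B14.Eq213MaximalDomains.side (F.P K).L M (j + 1) - 1 : ℕ) : ℝ) * (b j * (F.P K).eta j ^ 2)
            = (((F.P K).d - 1 : ℕ) : ℝ) * ((((B14.Eq213MaximalDomains.side (F.P K).L M (j + 1) - 1 : ℕ) : ℝ)) * (F.P K).eta j) * (F.P K).eta j * b j := by ring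
          _ ≤ (((F.P K).d - 1 : ℕ) : ℝ) * ((F.P K).L * M) * (F.P K).eta j * b j := by gcongr
          _ ≤ 1 / 2 := hsmallI j h1 hjk
      have hcB' : 2 * ((((F.P K).d - 1 : ℕ) : ℝ) * ((B14.Eq213MaximalDomains.side (F.P K).L M (j + 1) - 1 : ℕ) : ℝ) * (b j * (F.P K).eta j ^ 2)) / (F.P K).eta j <
          S.cB * S.lf.alpha0 (S.flow.g j) := by
        rw [div_lt_iff₀ hηj]
        have hbα := hbα' j h1 hjk
        calc 2 * ((((F.P K).d - 1 : ℕ) : ℝ) * ((B14.Eq213MaximalDomains.side (F.P K).L M (j + 1) - 1 : ℕ) : ℝ) * (b j * (F.P K).eta j ^ 2))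
            = (2 * (((F.P K).d - 1 : ℕ) : ℝ) * ((((B14.Eq213MaximalDomains.side (F.P K).L M (j + 1) - 1 : ℕ) : ℝ)) * (F.P K).eta j) * b j) * (F.P K).eta j := by ring
          _ ≤ (2 * (((F.P K).d - 1 : ℕ) : ℝ) * ((F.P K).L * M) * S.lf.alpha0 (S.flow.g j)) * (F.P K).eta j := by gcongr
          _ < S.cB * S.lf.alpha0 (S.flow.g j) * (F.P K).eta j := by
            have := mul_lt_mul_of_pos_right hcB hα0
            nlinarith
      simp only [hι, h𝓜]
      exact localGauge_cubesI_of_classBound (hsN (j + 1) (by omega) (by omega)) hcubeΩ hbj0 hclassj hsmall hcB' (h3I hsol j h1 hjk X hX)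
    exact ofBackgroundC_UbgMSOfRecord_mem_spaceI_of_classBound S hι hS hpos.cB_pos ν M S.flow.g K k s W h1 hjk (hα j h1 hjk).1 (hα j h1 hjk).2 X hX
      (hbα' j h1 hjk) (fun hsol => hclass hsol j hjk) hloc
  · -- the `Ũ^c_j` conjunct: class bounds at the scales `≤ j`, (2.34) plaquettes, (2.38)(a)(b) by the axial gauge on the layer cubes, (c) displayed
    have h238 : W ∈ solvableDom (avOfRecord F N K) (regMSOfRecord F N ν K k s.Ω) (genSet s.Ω k) →
        CondII238 S.𝓜 (Sect2.frameMS (Sect2.Residual.unit (F.P K) (MatA N)) M j (Sect2.domSites (F.P K) M j X) s.Ω)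
          (MSConsts.ofParams (F.P K) S.βc S.B S.C S.Mr j) (fun n => S.lf.alpha0 (S.flow.g n)) (fun b' => S.ι (UbgMSOfRecord F N ν M S.flow.g K k s W b')) := by
      intro hsol
      have hclassn : ∀ n, 1 ≤ n → n ≤ j →
          PlaqSmallOn (B8Eq17ClassAkV1.plaqsOf (s.Ω n)) (b n * (F.P K).eta n ^ 2) (UbgMSOfRecord F N ν M S.flow.g K k s W) := by
        intro n hn1 hnj
        have h := hclass hsol n (hnj.trans hjk)
        rwa [omegaPlaqs_of_ne_zero _ (Nat.one_le_iff_ne_zero.mp hn1)] at h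
      have key : ∀ n, 1 ≤ n → n ≤ j →
          (((F.P K).d - 1 : ℕ) : ℝ) * ((B14.Eq213MaximalDomains.side (F.P K).L M n - 1 : ℕ) : ℝ) * (b n * (F.P K).eta n ^ 2) ≤
            (((F.P K).d - 1 : ℕ) : ℝ) * M * (F.P K).eta n * b n := by
        intro n hn1 hnj
        have hside := side_pred_mul_eta_le' (P := F.P K) M n
        have hηn : 0 ≤ (F.P K).eta n := (pow_pos (inv_pos.mpr (Nat.cast_pos.mpr (F.P K).L_pos)) n).le
        have hbn0 := hb0 n (hnj.trans hjk)
        calc (((F.P K).d - 1 : ℕ) : ℝ) * ((B14.Eq213MaximalDomains.side (F.P K).L M n - 1 : ℕ) : ℝ) * (b n * (F.P K).eta n ^ 2)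
            = (((F.P K).d - 1 : ℕ) : ℝ) * (((B14.Eq213MaximalDomains.side (F.P K).L M n - 1 : ℕ) : ℝ) * (F.P K).eta n) * (F.P K).eta n * b n := by ring
          _ ≤ (((F.P K).d - 1 : ℕ) : ℝ) * M * (F.P K).eta n * b n := by gcongr
      simp only [hι, h𝓜]
      refine condII238_cubesMS_of_classBounds (fun n hn1 hnj => hsN n hn1 (by omega)) (fun n _ hnj => hb0 n (hnj.trans hjk)) hclassn
        (fun n hn1 hnj => (key n hn1 hnj).trans (hsmallMS n hn1 (hnj.trans hjk))) (fun n hn1 hnj => ?_)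
        (fun n hn1 hnj a ha hne hΩ q hq => h3MS hsol j h1 hjk X n hn1 hnj a ha hne hΩ q hq)
      have hα0 := (hα n hn1 (hnj.trans hjk)).1
      have hside := side_pred_mul_eta_le' (P := F.P K) M n
      have hbn0 := hb0 n (hnj.trans hjk)
      have hbα := hbα' n hn1 (hnj.trans hjk)
      have hLη := L_pow_mul_eta (P := F.P K) n
      rw [mul_div_assoc', div_lt_iff₀ hηj]
      unfold rad238
      calc ((F.P K).L : ℝ) ^ n * (F.P K).eta j * (2 * ((((F.P K).d - 1 : ℕ) : ℝ) * ((B14.Eq213MaximalDomains.side (F.P K).L M n - 1 : ℕ) : ℝ) * (b n * (F.P K).eta n ^ 2)))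
          = (2 * (((F.P K).d - 1 : ℕ) : ℝ) * (((B14.Eq213MaximalDomains.side (F.P K).L M n - 1 : ℕ) : ℝ) * (F.P K).eta n) *
              (((F.P K).L : ℝ) ^ n * (F.P K).eta n) * b n) * (F.P K).eta j := by ring
        _ ≤ (2 * (((F.P K).d - 1 : ℕ) : ℝ) * M * 1 * S.lf.alpha0 (S.flow.g n)) * (F.P K).eta j := by rw [hLη]; gcongr
        _ < S.B * S.C * S.Mr * S.lf.alpha0 (S.flow.g n) * (F.P K).eta j := by
            have := mul_lt_mul_of_pos_right hBCM hα0
            nlinarith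
    exact ofBackgroundC_UbgMSOfRecord_mem_spaceMS_of_classBound S hι hS hpos ν M K k s W (fun n hn1 hnj => hα n hn1 (hnj.trans hjk)) X
      (fun n hn1 hnj => hbα n hn1 (hnj.trans hjk)) (fun hsol n hn1 hnj => hclass hsol n (hnj.trans hjk)) h238


/-- **★★ THE ROW'S BODY AT `(s, 𝐖)` FROM THE TWO PER-SCALE CLASS BOUNDS FOR THAT DATUM** — plaquette `b_n·η_n²` and the covariant C¹ datum `b′_n·η_n³` on the plaquettes inside
`Ω_n` (FILE 7b's route: `h3I`∕`h3MS` supplied by `h3I_of_plaqC1`∕`h3MS_of_plaqC1`) + numerics + (C1)(C2) + no wrapping + the two scale-free letters. [cite: Balaban1988Convergent, (2.27)–(2.28) p.259, (2.34)–(2.41) p.261; Balaban1987RG1, (1.11)–(1.16) p.262; Balaban1985Variational, Thm 1 (8)–(10) p.279] -/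
theorem bgRowAtDatum_of_classBoundsC1 (S : Sect2.Setting (MatA N) (SU N)) (hι : S.ι = ιSU N) (h𝓜 : S.𝓜 = B12RegularSpaces111SpecialUnitary.suModel N) (hS : S.Laws)
    (hpos : S.Pos) (ν : Stage7Numerics) {M : ℕ} (hM : 0 < M) (K k : ℕ) {b b' : ℕ → ℝ} (hb0 : ∀ n, n ≤ k → 0 ≤ b n) (hb'0 : ∀ n, n ≤ k → 0 ≤ b' n)
    (s : SeqOfRecord F ν M S.flow.g K k) (W : MSField (F.P K) (SU N))
    (hclass : W ∈ solvableDom (avOfRecord F N K) (regMSOfRecord F N ν K k s.Ω) (genSet s.Ω k) →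
      ∀ n, n ≤ k → PlaqSmallOn (omegaPlaqs s.Ω n) (b n * (F.P K).eta n ^ 2) (UbgMSOfRecord F N ν M S.flow.g K k s W))
    (hclassC1 : W ∈ solvableDom (avOfRecord F N K) (regMSOfRecord F N ν K k s.Ω) (genSet s.Ω k) →
      ∀ n, 1 ≤ n → n ≤ k → PlaqC1SmallOn (plaqInside (s.Ω n)) (b' n * (F.P K).eta n ^ 3) (UbgMSOfRecord F N ν M S.flow.g K k s W))
    (hα : ∀ n, 1 ≤ n → n ≤ k → 0 < S.lf.alpha0 (S.flow.g n) ∧ 0 < S.lf.alpha1 (S.flow.g n))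
    (hbα : ∀ n, 1 ≤ n → n ≤ k → b n ≤ (1 - S.βc) * S.lf.alpha0 (S.flow.g n))
    (hsN : ∀ n, 1 ≤ n → n ≤ k + 1 → ((B14.Eq213MaximalDomains.side (F.P K).L M n : ℕ) : ℤ) < (F.P K).sitesPerDir 0)
    (hcB : 2 * (((F.P K).d - 1 : ℕ) : ℝ) * ((F.P K).L * M) < S.cB) (hBCM : 2 * (((F.P K).d - 1 : ℕ) : ℝ) * M < S.B * S.C * S.Mr)
    (hsmallI : ∀ j, 1 ≤ j → j ≤ k → (((F.P K).d - 1 : ℕ) : ℝ) * ((F.P K).L * M) * (F.P K).eta j * b j ≤ 1 / 2)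
    (hsmallMS : ∀ n, 1 ≤ n → n ≤ k → (((F.P K).d - 1 : ℕ) : ℝ) * M * (F.P K).eta n * b n ≤ 1 / 2)
    (hC1 : ∀ j, 1 ≤ j → j ≤ k → ∃ t : ℕ, 0 < t ∧ RkOfRecord (F.P K).L ν.r (S.flow.g j) = (F.P K).L * t)
    (hC2 : ∀ j, 1 ≤ j → j ≤ k → dCubeSide (F.P K).L M (RkOfRecord (F.P K).L ν.r (S.flow.g j)) j ∣ (F.P K).sitesPerDir 0)
    (hletterI : ∀ j, 1 ≤ j → j ≤ k →
      4 * (b j + (((F.P K).d - 1 : ℕ) : ℝ) * (((F.P K).L : ℝ) * M) * b' j + 4 * ((((F.P K).d - 1 : ℕ) : ℝ) * (((F.P K).L : ℝ) * M)) ^ 2 * b j ^ 2) <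
        S.cB * S.lf.alpha0 (S.flow.g j))
    (hletterMS : ∀ n, 1 ≤ n → n ≤ k →
      4 * (b n + (((F.P K).d - 1 : ℕ) : ℝ) * (M : ℝ) * b' n + 4 * ((((F.P K).d - 1 : ℕ) : ℝ) * (M : ℝ)) ^ 2 * b n ^ 2) < rad238 S.B S.C S.Mr (S.lf.alpha0 (S.flow.g n))) :
    ∀ j, 1 ≤ j → j ≤ k → ∀ X : (Sect2.domSys (F.P K) M j).Dom,
      (Sect2.domSites (F.P K) M j X ⊆ s.Λ j →
        Sect2.ofBackgroundC S.ι (UbgMSOfRecord F N ν M S.flow.g K k s W) ∈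
          Sect2.spaceI S (Sect2.Residual.unit (F.P K) (MatA N)) M j (Sect2.domSites (F.P K) M j X) (S.lf.alpha0 (S.flow.g j)) (S.lf.alpha1 (S.flow.g j))) ∧
      (Sect2.admB (F.P K) ν M S.flow.g s.Ω s.Λ j (Sect2.domSites (F.P K) M j X) = true →
        Sect2.ofBackgroundC S.ι (UbgMSOfRecord F N ν M S.flow.g K k s W) ∈
          Sect2.spaceMS S (Sect2.Residual.unit (F.P K) (MatA N)) M j (Sect2.domSites (F.P K) M j X) s.Ω) := by
  refine bgRowAtDatum_of_classBounds S hι h𝓜 hS hpos ν hM K k hb0 s W hclass hα hbα hsN hcB hBCM hsmallI hsmallMS hC1 hC2 ?_ ?_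
  · intro hsol j h1 hjk X hX
    have hclassj : PlaqSmallOn (B8Eq17ClassAkV1.plaqsOf (s.Ω j)) (b j * (F.P K).eta j ^ 2) (UbgMSOfRecord F N ν M S.flow.g K k s W) := by
      have := hclass hsol j hjk
      rwa [omegaPlaqs_of_ne_zero _ (Nat.one_le_iff_ne_zero.mp h1)] at this
    exact h3I_of_plaqC1 (hsN (j + 1) (by omega) (by omega)) (hcubeΩ_of_compatible ν hM S.flow.g K k s hC1 hC2 j h1 hjk X hX) (hb0 j hjk) (hb'0 j hjk)
      hclassj (hclassC1 hsol j h1 hjk) (hsmall_side_of_LM M j (hb0 j hjk) (hsmallI j h1 hjk)) (hletterI j h1 hjk)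
  · intro hsol j h1 hjk X n hn1 hnj
    refine h3MS_of_plaqC1 (j := j) (Y := Sect2.domSites (F.P K) M j X) (fun n hn1 hnj => hsN n hn1 (by omega)) (fun n _ hnj => hb0 n (by omega))
      (fun n _ hnj => hb'0 n (by omega)) (fun n hn1 hnj => ?_) (fun n hn1 hnj => hclassC1 hsol n hn1 (by omega))
      (fun n hn1 hnj => hsmall_side_of_M M n (hb0 n (by omega)) (hsmallMS n hn1 (by omega))) (fun n hn1 hnj => hletterMS n hn1 (by omega)) n hn1 hnj
    have := hclass hsol n (by omega)
    rwa [omegaPlaqs_of_ne_zero _ (Nat.one_le_iff_ne_zero.mp hn1)] at this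

/-- **★★★ ROW P11's BODY AT `(s, 𝐖)` FROM THE RE-TYPED FACT** — `VariationalThm1RegSepMixed` ([15] Thm 1, (R), print's sequences, print's data (7)) for the plaquette class bound,
PRINT'S (7) ON THE DATUM (`h7`, thresholds `cR·ε_n` — the clause a faithful support of record carries), the displayed C¹ class clause `B₃′·cR·ε_n·η_n³` ([15] Thm 1 (9)–(10),
gauge-free reading), the numerics incl. FILE 7c's two «C₀ large» letters, (C1)(C2), no wrapping, `hcomp`.  Compared with FILE 7c's `bgRowAt_of_thm1ScaledSepC1_letters`: `h15` re-keyed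
to the inhabitable fact and ONE MORE displayed per-datum hypothesis `h7`; no support membership is used. [cite: Balaban1985Variational, Thm 1 (7)–(10) pp.278–279; Balaban1985RegularSpaces, (1.3)–(1.8) p.77; Balaban1988Convergent, (2.4)–(2.8) pp.255–256, (2.27)–(2.28) p.259, (2.34)–(2.41) p.261; Balaban1987RG1, (1.11)–(1.16) p.262] -/
theorem bgRowAtDatum_of_thm1RegSepMixedC1 {B₃ B₃' a₀ a₁ tI tMS : ℝ} (h15 : VariationalThm1RegSepMixed F N B₃ a₀ a₁)
    (S : Sect2.Setting (MatA N) (SU N)) (hι : S.ι = ιSU N) (h𝓜 : S.𝓜 = B12RegularSpaces111SpecialUnitary.suModel N) (hS : S.Laws) (hpos : S.Pos)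
    (ν : Stage7Numerics) {M : ℕ} (hM : 0 < M) (K k : ℕ) (cR : ℝ) (hB₃ : 0 ≤ B₃) (hB₃' : 0 ≤ B₃')
    (hg : ∀ j, 1 ≤ j → j ≤ k → 0 < S.flow.g j ∧ S.flow.g j ^ 2 ≤ Real.exp (-1)) (hpq : ν.p₀ ≤ S.lf.q₀)
    (hnum : ∀ n, n ≤ k → 0 < cR * epsOfRecord ν S.flow.g n ∧ cR * epsOfRecord ν S.flow.g n ≤ a₁ ∧ B₃ * (cR * epsOfRecord ν S.flow.g n) ≤ ν.εreg)
    (ha₀ : ν.εreg ≤ a₀) (hcomp : ∀ n, n < k → cR * epsOfRecord ν S.flow.g n ≤ 2 * (cR * epsOfRecord ν S.flow.g (n + 1)))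
    (hα : ∀ n, 1 ≤ n → n ≤ k → 0 < S.lf.alpha0 (S.flow.g n) ∧ 0 < S.lf.alpha1 (S.flow.g n))
    (hBα : ∀ n, 1 ≤ n → n ≤ k → B₃ * (cR * epsOfRecord ν S.flow.g n) ≤ (1 - S.βc) * S.lf.alpha0 (S.flow.g n))
    (hΛI0 : 0 ≤ (4 * (B₃ + (((F.P K).d - 1 : ℕ) : ℝ) * (((F.P K).L : ℝ) * M) * B₃') + 16 * ((((F.P K).d - 1 : ℕ) : ℝ) * (((F.P K).L : ℝ) * M)) ^ 2 * B₃ ^ 2 * a₁) * cR * ν.A₀)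
    (hΛI : (4 * (B₃ + (((F.P K).d - 1 : ℕ) : ℝ) * (((F.P K).L : ℝ) * M) * B₃') + 16 * ((((F.P K).d - 1 : ℕ) : ℝ) * (((F.P K).L : ℝ) * M)) ^ 2 * B₃ ^ 2 * a₁) * cR * ν.A₀ ≤
      tI * S.lf.C₀) (htI : tI < S.cB)
    (hΛMS0 : 0 ≤ (4 * (B₃ + (((F.P K).d - 1 : ℕ) : ℝ) * (M : ℝ) * B₃') + 16 * ((((F.P K).d - 1 : ℕ) : ℝ) * (M : ℝ)) ^ 2 * B₃ ^ 2 * a₁) * cR * ν.A₀)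
    (hΛMS : (4 * (B₃ + (((F.P K).d - 1 : ℕ) : ℝ) * (M : ℝ) * B₃') + 16 * ((((F.P K).d - 1 : ℕ) : ℝ) * (M : ℝ)) ^ 2 * B₃ ^ 2 * a₁) * cR * ν.A₀ ≤ tMS * S.lf.C₀)
    (htMS : tMS < S.B * S.C * S.Mr)
    (hsN : ∀ n, 1 ≤ n → n ≤ k + 1 → ((B14.Eq213MaximalDomains.side (F.P K).L M n : ℕ) : ℤ) < (F.P K).sitesPerDir 0)
    (hcB : 2 * (((F.P K).d - 1 : ℕ) : ℝ) * ((F.P K).L * M) < S.cB) (hBCM : 2 * (((F.P K).d - 1 : ℕ) : ℝ) * M < S.B * S.C * S.Mr)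
    (hsmallI : ∀ j, 1 ≤ j → j ≤ k → (((F.P K).d - 1 : ℕ) : ℝ) * ((F.P K).L * M) * (F.P K).eta j * (B₃ * (cR * epsOfRecord ν S.flow.g j)) ≤ 1 / 2)
    (hsmallMS : ∀ n, 1 ≤ n → n ≤ k → (((F.P K).d - 1 : ℕ) : ℝ) * M * (F.P K).eta n * (B₃ * (cR * epsOfRecord ν S.flow.g n)) ≤ 1 / 2)
    (hC1 : ∀ j, 1 ≤ j → j ≤ k → ∃ t : ℕ, 0 < t ∧ RkOfRecord (F.P K).L ν.r (S.flow.g j) = (F.P K).L * t)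
    (hC2 : ∀ j, 1 ≤ j → j ≤ k → dCubeSide (F.P K).L M (RkOfRecord (F.P K).L ν.r (S.flow.g j)) j ∣ (F.P K).sitesPerDir 0)
    (s : SeqOfRecord F ν M S.flow.g K k) (hsep : Sect2.SeqSeparated ν.M₁ s) (W : MSField (F.P K) (SU N))
    (h7 : Sect2.DataSmall7 (avOfRecord F N K) s.Ω k (fun n => cR * epsOfRecord ν S.flow.g n) W)
    (hclassC1 : W ∈ solvableDom (avOfRecord F N K) (regMSOfRecord F N ν K k s.Ω) (genSet s.Ω k) →
      ∀ n, 1 ≤ n → n ≤ k →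
        PlaqC1SmallOn (plaqInside (s.Ω n)) (B₃' * (cR * epsOfRecord ν S.flow.g n) * (F.P K).eta n ^ 3) (UbgMSOfRecord F N ν M S.flow.g K k s W)) :
    ∀ j, 1 ≤ j → j ≤ k → ∀ X : (Sect2.domSys (F.P K) M j).Dom,
      (Sect2.domSites (F.P K) M j X ⊆ s.Λ j →
        Sect2.ofBackgroundC S.ι (UbgMSOfRecord F N ν M S.flow.g K k s W) ∈
          Sect2.spaceI S (Sect2.Residual.unit (F.P K) (MatA N)) M j (Sect2.domSites (F.P K) M j X) (S.lf.alpha0 (S.flow.g j)) (S.lf.alpha1 (S.flow.g j))) ∧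
      (Sect2.admB (F.P K) ν M S.flow.g s.Ω s.Λ j (Sect2.domSites (F.P K) M j X) = true →
        Sect2.ofBackgroundC S.ι (UbgMSOfRecord F N ν M S.flow.g K k s W) ∈
          Sect2.spaceMS S (Sect2.Residual.unit (F.P K) (MatA N)) M j (Sect2.domSites (F.P K) M j X) s.Ω) :=
  bgRowAtDatum_of_classBoundsC1 S hι h𝓜 hS hpos ν hM K k (fun n hn => mul_nonneg hB₃ (hnum n hn).1.le) (fun n hn => mul_nonneg hB₃' (hnum n hn).1.le) s W
    (fun hsol => plaqSmallOn_UbgMSOfRecord_of_thm1RegSepMixed h15 ν M S.flow.g K k cR s hsep hnum ha₀ hcomp h7 hsol)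
    hclassC1 hα hBα hsN hcB hBCM hsmallI hsmallMS hC1 hC2
    (hletterI_of_numerics S.lf ν M hg hpq (fun j hj => ⟨(hnum j hj).1, (hnum j hj).2.1⟩) hΛI0 hΛI htI (fun j h1 hj => (hα j h1 hj).1))
    (hletterMS_of_numerics S.lf ν M hg hpq (fun n hn => ⟨(hnum n hn).1, (hnum n hn).2.1⟩) hΛMS0 hΛMS htMS (fun n h1 hn => (hα n h1 hn).1))

end Record

/-! ## §5 (v1.1, append-only)  ONE CARRIER: print's (7) field IS r12's splice `B15DeterminingSets.spliceAt` (dag-lead DEDUP-257 (A)) -/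

section Carrier

variable {P : Params} {G : Type*} [GaugeGroup G]

/-- **ONE CARRIER, DEFINITIONALLY**: `Sect2.mixedField av S Wn Wm` IS `B15DeterminingSets.spliceAt S Wn ((av m).avg Wm)` — the tree's V∕V̄ splice (1.20) [IV] with the
averaged finer datum in the second slot — by `rfl` (same `if b ∈ bondsOf S then … else …` body); dag-n21-c's C′ repair-shape theorems over `spliceAt` and this file's
`Sect2.DataSmall7` therefore speak about the same function (dag-lead DEDUP-257 (A)). [cite: Balaban1985Variational, (7) p.278 L26–33; Balaban1989LargeFieldI, (1.20) p.180 (bookkeeping)] -/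
theorem Sect2.mixedField_eq_spliceAt (av : ∀ j, Averaging P j G) {m : ℕ} (S : Set (Site P (m + 1))) (Wn : GaugeField P (m + 1) G) (Wm : GaugeField P m G) :
    Sect2.mixedField av S Wn Wm = spliceAt S Wn ((av m).avg Wm) := rfl

/-- The level-`(m+1)` clause of (7) in the `spliceAt` spelling. [cite: Balaban1985Variational, (7) p.278 (bookkeeping)] -/
theorem Sect2.DataSmall7.succ_spliceAt {av : ∀ j, Averaging P j G} {Ω : ℕ → Set (Site P 0)} {k : ℕ} {δ : ℕ → ℝ} {W : MSField P G}
    (h : Sect2.DataSmall7 av Ω k δ W) {m : ℕ} (hm : m + 1 ≤ k) :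
    PlaqSmallOn (B8Eq17ClassAkV1.plaqsOf (genSet Ω k (m + 1))) (δ (m + 1)) (spliceAt (genSet Ω k (m + 1)) (W (m + 1)) ((av m).avg (W m))) := h.2 m hm

/-- (7) FROM ITS TWO CLAUSES in the `spliceAt` spelling (the constructor consumers of a support guard use). [cite: Balaban1985Variational, (7) p.278 (bookkeeping)] -/
theorem Sect2.DataSmall7.of_spliceAt {av : ∀ j, Averaging P j G} {Ω : ℕ → Set (Site P 0)} {k : ℕ} {δ : ℕ → ℝ} {W : MSField P G}
    (h0 : PlaqSmallOn (plaqInside (genSet Ω k 0)) (δ 0) (W 0))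
    (hsucc : ∀ m, m + 1 ≤ k → PlaqSmallOn (B8Eq17ClassAkV1.plaqsOf (genSet Ω k (m + 1))) (δ (m + 1)) (spliceAt (genSet Ω k (m + 1)) (W (m + 1)) ((av m).avg (W m)))) :
    Sect2.DataSmall7 av Ω k δ W := ⟨h0, hsucc⟩

end Carrier

/-! ## §6 (v1.2, append-only)  PRINT'S (7), OUTER CASE ONLY (HYP-AUDIT-13 H6, dag-ref-G NOTE-7-INNER): the (7)-faithful data predicate `DataSmall7Outer`
and the named fact over it -/

section Outer

variable {P : Params} {G : Type*} [GaugeGroup G]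

/-- **THE PLAQUETTES OF (7) AT LEVEL `n`, OUTER CASE** (HYP-AUDIT-13 row H6 with dag-ref-G's NOTE-7-INNER): the level-`n` plaquettes TOUCHING `Γ_n` (`plaqsOf (genSet Ω k n)`) none of
whose corners lies in the deeper region `Ω_{n+1}` (`pts n (Ω (n+1))`).  Print ([15] p.278 L26–33) defines `(∂V)(p′)` for `p′ ⊂ Λ_n` and for `p′` meeting `∂Λ_n` with the off-`Λ_n`
bonds in the FINER region («y, z ∈ Λ_{j−1}», value `V̄`); a level-`n` plaquette reaching INTO `Ω_{n+1}` carries no level-`n` datum there and (7) says nothing about it — so it is EXCLUDED here.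
At `n = 0` this is «p′ ⊂ Λ₀». [cite: Balaban1985Variational, (7) p.278 L20–33] -/
def Sect2.outerPlaqs (Ω : ℕ → Set (Site P 0)) (k n : ℕ) : Set (Plaq P n) :=
  {p | p ∈ B8Eq17ClassAkV1.plaqsOf (genSet Ω k n) ∧ p.src ∉ pts n (Ω (n + 1)) ∧ p.src.shift p.μ ∉ pts n (Ω (n + 1)) ∧
    p.src.shift p.ν ∉ pts n (Ω (n + 1)) ∧ (p.src.shift p.μ).shift p.ν ∉ pts n (Ω (n + 1))}

/-- The outer plaquettes touch `Γ_n`. [cite: Balaban1985Variational, (7) p.278 (bookkeeping)] -/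
theorem Sect2.outerPlaqs_subset_plaqsOf (Ω : ℕ → Set (Site P 0)) (k n : ℕ) : Sect2.outerPlaqs Ω k n ⊆ B8Eq17ClassAkV1.plaqsOf (genSet Ω k n) :=
  fun _ hp => hp.1

/-- **PRINT'S DATA HYPOTHESIS (7), FAITHFUL RANGE** («|(∂V)(p′) − 1| < ε₁ for p′ ∈ 𝔅» with p.278's rule; thresholds `δ_n` at scale `n`): at level 0 the datum `W 0` on the outer
plaquettes of `Γ₀` (= all corners in `Γ₀`); at level `m+1 ≤ k` the (7) field `Sect2.mixedField` (= `spliceAt … (W (m+1)) ((av m).avg (W m))`) on the OUTER plaquettes of `Γ_{m+1}`.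
Compared with `Sect2.DataSmall7` (§1): the inner-reaching plaquettes (a corner in `Ω_{n+1}`), on which print imposes nothing, are DROPPED — so this predicate admits every datum print
admits (HYP-AUDIT-13 H6). `DataSmall7 → DataSmall7Outer` (`Sect2.DataSmall7.toOuter`).
-- TODO(general form): (7) is stated for an arbitrary admissible `𝔅_k` of [6] Sect. A; here `𝔅_k = genSet Ω k` of a (2.18) index.
[cite: Balaban1985Variational, (7) p.278 L20–33; Balaban1985RegularSpaces, (1.3)–(1.9) p.77; Balaban1988Convergent, (2.10)–(2.12) p.256] -/
def Sect2.DataSmall7Outer (av : ∀ j, Averaging P j G) (Ω : ℕ → Set (Site P 0)) (k : ℕ) (δ : ℕ → ℝ) (W : MSField P G) : Prop :=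
  PlaqSmallOn (Sect2.outerPlaqs Ω k 0) (δ 0) (W 0) ∧
    ∀ m, m + 1 ≤ k → PlaqSmallOn (Sect2.outerPlaqs Ω k (m + 1)) (δ (m + 1)) (Sect2.mixedField av (genSet Ω k (m + 1)) (W (m + 1)) (W m))

/-- The level-0 outer plaquettes are plaquettes INSIDE `Γ₀` (all four corners): `genSet Ω k 0 ⊆ (Ω 1)ᶜ`-type bookkeeping is not needed — the clause of §1 (`plaqInside (genSet Ω k 0)`)
restricts to them. [cite: Balaban1985Variational, (7) p.278 (bookkeeping)] -/
theorem Sect2.DataSmall7.toOuter {av : ∀ j, Averaging P j G} {Ω : ℕ → Set (Site P 0)} {k : ℕ} {δ : ℕ → ℝ} {W : MSField P G} (h : Sect2.DataSmall7 av Ω k δ W)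
    (h0 : Sect2.outerPlaqs Ω k 0 ⊆ plaqInside (genSet Ω k 0)) : Sect2.DataSmall7Outer av Ω k δ W :=
  ⟨fun p hp => h.1 p (h0 hp), fun m hm p hp => h.2 m hm p (Sect2.outerPlaqs_subset_plaqsOf Ω k (m + 1) hp)⟩

/-- The level-`(m+1)` clause of the faithful (7). [cite: Balaban1985Variational, (7) p.278 (bookkeeping)] -/
theorem Sect2.DataSmall7Outer.succ {av : ∀ j, Averaging P j G} {Ω : ℕ → Set (Site P 0)} {k : ℕ} {δ : ℕ → ℝ} {W : MSField P G} (h : Sect2.DataSmall7Outer av Ω k δ W)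
    {m : ℕ} (hm : m + 1 ≤ k) :
    PlaqSmallOn (Sect2.outerPlaqs Ω k (m + 1)) (δ (m + 1)) (spliceAt (genSet Ω k (m + 1)) (W (m + 1)) ((av m).avg (W m))) := h.2 m hm

/-- The faithful (7) FROM ITS TWO CLAUSES in the `spliceAt` spelling (the constructor a support guard's consumer uses). [cite: Balaban1985Variational, (7) p.278 (bookkeeping)] -/
theorem Sect2.DataSmall7Outer.of_spliceAt {av : ∀ j, Averaging P j G} {Ω : ℕ → Set (Site P 0)} {k : ℕ} {δ : ℕ → ℝ} {W : MSField P G}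
    (h0 : PlaqSmallOn (Sect2.outerPlaqs Ω k 0) (δ 0) (W 0))
    (hsucc : ∀ m, m + 1 ≤ k → PlaqSmallOn (Sect2.outerPlaqs Ω k (m + 1)) (δ (m + 1)) (spliceAt (genSet Ω k (m + 1)) (W (m + 1)) ((av m).avg (W m)))) :
    Sect2.DataSmall7Outer av Ω k δ W := ⟨h0, hsucc⟩

/-- Weakening the thresholds of the faithful (7). [cite: Balaban1985Variational, (7) p.278 (bookkeeping)] -/
theorem Sect2.DataSmall7Outer.of_le {av : ∀ j, Averaging P j G} {Ω : ℕ → Set (Site P 0)} {k : ℕ} {δ δ' : ℕ → ℝ} {W : MSField P G} (h : Sect2.DataSmall7Outer av Ω k δ W)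
    (hδ : ∀ n, n ≤ k → δ n ≤ δ' n) : Sect2.DataSmall7Outer av Ω k δ' W :=
  ⟨fun p hp => (h.1 p hp).trans_le (hδ 0 (Nat.zero_le _)), fun m hm p hp => (h.2 m hm p hp).trans_le (hδ (m + 1) hm)⟩

end Outer

section NamedFactOuter

variable (F : T4Family) (N : ℕ) [NeZero N]

/-- **★★ [15] THEOREM 1, (R), per scale, print's sequences, PRINT'S DATA (7) IN ITS FAITHFUL RANGE** — `VariationalThm1RegSepMixed` (§2) with the data hypothesis `Sect2.DataSmall7`
REPLACED by `Sect2.DataSmall7Outer` (HYP-AUDIT-13 H6: the inner-reaching plaquettes, on which print says nothing, are no longer demanded): a STRONGER statement (more data admitted) and the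
print-faithful one; it implies the §2 fact (`VariationalThm1RegSepOuter.toMixed`, given the level-0 inclusion).  Everything else verbatim: separated `s` ([6] (1.3)–(1.6), record
`Sect2.SeqSeparated ν.M₁ s` = R = L in (1)'s units — [15] (1) asks `R ≥ R₁`, a located letter), thresholds `0 < δ_n ≤ a₁`, `B₃δ_n ≤ ε₀ ≤ a₀`, comparable (`δ_n ≤ 2δ_{n+1}`), and for EVERY minimiser
of (2.12) over the class of threshold `ε₀` (the record's class carries [6] (1.7) only — print's (6) carries also (1.9) `|D^{η*}_U∂U(b)| < ε₀η²(L^jη)^{−3}`, a located difference logged as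
HYP-AUDIT-13 №6) the class bound `B₃δ_n·η_n²` on the plaquettes meeting `Ω_n(s)`.  NEVER asserted; constants as parameters.
-- TODO(general form): ONE threshold ε₁ in print; general admissible `{Ω_j}`∕`𝔅_k`; print's class (6)∕(8) carries the co-divergence member (1.9).
[cite: Balaban1985Variational, Thm 1 (2),(7)–(8) pp.278–279; Balaban1985RegularSpaces, (1.3)–(1.9) p.77; Balaban1988Convergent, (2.7)–(2.8) pp.255–256, (2.12) p.256, p.259] -/
def VariationalThm1RegSepOuter (B₃ a₀ a₁ : ℝ) : Prop :=
  ∀ (ν : Stage7Numerics) (M : ℕ) (g : ℕ → ℝ) (K k : ℕ) (s : SeqOfRecord F ν M g K k), Sect2.SeqSeparated ν.M₁ s → ∀ (ε₀ : ℝ) (δ : ℕ → ℝ),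
    (∀ n, n ≤ k → 0 < δ n ∧ δ n ≤ a₁ ∧ B₃ * δ n ≤ ε₀) → (∀ n, n < k → δ n ≤ 2 * δ (n + 1)) → ε₀ ≤ a₀ →
    ∀ W : MSField (F.P K) (SU N), Sect2.DataSmall7Outer (avOfRecord F N K) s.Ω k δ W →
      ∀ U₀, IsMinimizer (avOfRecord F N K) {U | ∀ n, n ≤ k → PlaqSmallOn (omegaPlaqs s.Ω n) (ε₀ * (F.P K).eta n ^ 2) U} (genSet s.Ω k) W U₀ →
        ∀ n, n ≤ k → PlaqSmallOn (omegaPlaqs s.Ω n) (B₃ * δ n * (F.P K).eta n ^ 2) U₀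

variable {F N}

/-- The faithful-range fact implies the §2 fact (whose data hypothesis is stronger), given the level-0 inclusion of the outer plaquettes in `plaqInside Γ₀`. [cite: Balaban1985Variational, Thm 1 (7)–(8) pp.278–279 (bookkeeping)] -/
theorem VariationalThm1RegSepOuter.toMixed {B₃ a₀ a₁ : ℝ} (h : VariationalThm1RegSepOuter F N B₃ a₀ a₁)
    (h0 : ∀ (K k : ℕ) (Ω : ℕ → Set (Site (F.P K) 0)), Sect2.outerPlaqs Ω k 0 ⊆ plaqInside (genSet Ω k 0)) : VariationalThm1RegSepMixed F N B₃ a₀ a₁ :=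
  fun ν M g K k s hsep ε₀ δ hδ hcomp hε₀ W h7 => h ν M g K k s hsep ε₀ δ hδ hcomp hε₀ W (h7.toOuter (h0 K k s.Ω))

/-- **★ DEF-R'S BACKGROUND IS `B₃·cR·ε_n`-REGULAR AT EVERY SCALE FOR A DATUM SATISFYING PRINT'S (7) IN ITS FAITHFUL RANGE** (separated sequence, comparable thresholds, solvable fibre).
[cite: Balaban1985Variational, Thm 1 (7)–(8) pp.278–279; Balaban1988Convergent, (2.7)–(2.8) pp.255–256, (2.12) p.256, p.259] -/
theorem plaqSmallOn_UbgMSOfRecord_of_thm1RegSepOuter {B₃ a₀ a₁ : ℝ} (h15 : VariationalThm1RegSepOuter F N B₃ a₀ a₁) (ν : Stage7Numerics) (M : ℕ)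
    (g : ℕ → ℝ) (K k : ℕ) (cR : ℝ) (s : SeqOfRecord F ν M g K k) (hsep : Sect2.SeqSeparated ν.M₁ s)
    (hnum : ∀ n, n ≤ k → 0 < cR * epsOfRecord ν g n ∧ cR * epsOfRecord ν g n ≤ a₁ ∧ B₃ * (cR * epsOfRecord ν g n) ≤ ν.εreg) (ha₀ : ν.εreg ≤ a₀)
    (hcomp : ∀ n, n < k → cR * epsOfRecord ν g n ≤ 2 * (cR * epsOfRecord ν g (n + 1)))
    {W : MSField (F.P K) (SU N)} (h7 : Sect2.DataSmall7Outer (avOfRecord F N K) s.Ω k (fun n => cR * epsOfRecord ν g n) W)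
    (hsol : W ∈ solvableDom (avOfRecord F N K) (regMSOfRecord F N ν K k s.Ω) (genSet s.Ω k)) :
    ∀ n, n ≤ k → PlaqSmallOn (omegaPlaqs s.Ω n) (B₃ * (cR * epsOfRecord ν g n) * (F.P K).eta n ^ 2) (UbgMSOfRecord F N ν M g K k s W) :=
  h15 ν M g K k s hsep ν.εreg (fun n => cR * epsOfRecord ν g n) hnum hcomp ha₀ W h7 _ (isMinimizer_UbgMSOfRecord ν M g K k s hsol)

/-- **★★★ ROW P11's BODY AT `(s, 𝐖)` FROM THE FAITHFUL-RANGE FACT** — `bgRowAtDatum_of_thm1RegSepMixedC1` with `h15 : VariationalThm1RegSepOuter` and `h7 : Sect2.DataSmall7Outer … W`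
(the support guard of record reads this predicate). [cite: Balaban1985Variational, Thm 1 (7)–(10) pp.278–279; Balaban1985RegularSpaces, (1.3)–(1.9) p.77; Balaban1988Convergent, (2.4)–(2.8) pp.255–256, (2.27)–(2.28) p.259, (2.34)–(2.41) p.261; Balaban1987RG1, (1.11)–(1.16) p.262] -/
theorem bgRowAtDatum_of_thm1RegSepOuterC1 {B₃ B₃' a₀ a₁ tI tMS : ℝ} (h15 : VariationalThm1RegSepOuter F N B₃ a₀ a₁)
    (S : Sect2.Setting (MatA N) (SU N)) (hι : S.ι = ιSU N) (h𝓜 : S.𝓜 = B12RegularSpaces111SpecialUnitary.suModel N) (hS : S.Laws) (hpos : S.Pos)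
    (ν : Stage7Numerics) {M : ℕ} (hM : 0 < M) (K k : ℕ) (cR : ℝ) (hB₃ : 0 ≤ B₃) (hB₃' : 0 ≤ B₃')
    (hg : ∀ j, 1 ≤ j → j ≤ k → 0 < S.flow.g j ∧ S.flow.g j ^ 2 ≤ Real.exp (-1)) (hpq : ν.p₀ ≤ S.lf.q₀)
    (hnum : ∀ n, n ≤ k → 0 < cR * epsOfRecord ν S.flow.g n ∧ cR * epsOfRecord ν S.flow.g n ≤ a₁ ∧ B₃ * (cR * epsOfRecord ν S.flow.g n) ≤ ν.εreg)
    (ha₀ : ν.εreg ≤ a₀) (hcomp : ∀ n, n < k → cR * epsOfRecord ν S.flow.g n ≤ 2 * (cR * epsOfRecord ν S.flow.g (n + 1)))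
    (hα : ∀ n, 1 ≤ n → n ≤ k → 0 < S.lf.alpha0 (S.flow.g n) ∧ 0 < S.lf.alpha1 (S.flow.g n))
    (hBα : ∀ n, 1 ≤ n → n ≤ k → B₃ * (cR * epsOfRecord ν S.flow.g n) ≤ (1 - S.βc) * S.lf.alpha0 (S.flow.g n))
    (hΛI0 : 0 ≤ (4 * (B₃ + (((F.P K).d - 1 : ℕ) : ℝ) * (((F.P K).L : ℝ) * M) * B₃') + 16 * ((((F.P K).d - 1 : ℕ) : ℝ) * (((F.P K).L : ℝ) * M)) ^ 2 * B₃ ^ 2 * a₁) * cR * ν.A₀)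
    (hΛI : (4 * (B₃ + (((F.P K).d - 1 : ℕ) : ℝ) * (((F.P K).L : ℝ) * M) * B₃') + 16 * ((((F.P K).d - 1 : ℕ) : ℝ) * (((F.P K).L : ℝ) * M)) ^ 2 * B₃ ^ 2 * a₁) * cR * ν.A₀ ≤
      tI * S.lf.C₀) (htI : tI < S.cB)
    (hΛMS0 : 0 ≤ (4 * (B₃ + (((F.P K).d - 1 : ℕ) : ℝ) * (M : ℝ) * B₃') + 16 * ((((F.P K).d - 1 : ℕ) : ℝ) * (M : ℝ)) ^ 2 * B₃ ^ 2 * a₁) * cR * ν.A₀)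
    (hΛMS : (4 * (B₃ + (((F.P K).d - 1 : ℕ) : ℝ) * (M : ℝ) * B₃') + 16 * ((((F.P K).d - 1 : ℕ) : ℝ) * (M : ℝ)) ^ 2 * B₃ ^ 2 * a₁) * cR * ν.A₀ ≤ tMS * S.lf.C₀)
    (htMS : tMS < S.B * S.C * S.Mr)
    (hsN : ∀ n, 1 ≤ n → n ≤ k + 1 → ((B14.Eq213MaximalDomains.side (F.P K).L M n : ℕ) : ℤ) < (F.P K).sitesPerDir 0)
    (hcB : 2 * (((F.P K).d - 1 : ℕ) : ℝ) * ((F.P K).L * M) < S.cB) (hBCM : 2 * (((F.P K).d - 1 : ℕ) : ℝ) * M < S.B * S.C * S.Mr)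
    (hsmallI : ∀ j, 1 ≤ j → j ≤ k → (((F.P K).d - 1 : ℕ) : ℝ) * ((F.P K).L * M) * (F.P K).eta j * (B₃ * (cR * epsOfRecord ν S.flow.g j)) ≤ 1 / 2)
    (hsmallMS : ∀ n, 1 ≤ n → n ≤ k → (((F.P K).d - 1 : ℕ) : ℝ) * M * (F.P K).eta n * (B₃ * (cR * epsOfRecord ν S.flow.g n)) ≤ 1 / 2)
    (hC1 : ∀ j, 1 ≤ j → j ≤ k → ∃ t : ℕ, 0 < t ∧ RkOfRecord (F.P K).L ν.r (S.flow.g j) = (F.P K).L * t)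
    (hC2 : ∀ j, 1 ≤ j → j ≤ k → dCubeSide (F.P K).L M (RkOfRecord (F.P K).L ν.r (S.flow.g j)) j ∣ (F.P K).sitesPerDir 0)
    (s : SeqOfRecord F ν M S.flow.g K k) (hsep : Sect2.SeqSeparated ν.M₁ s) (W : MSField (F.P K) (SU N))
    (h7 : Sect2.DataSmall7Outer (avOfRecord F N K) s.Ω k (fun n => cR * epsOfRecord ν S.flow.g n) W)
    (hclassC1 : W ∈ solvableDom (avOfRecord F N K) (regMSOfRecord F N ν K k s.Ω) (genSet s.Ω k) →
      ∀ n, 1 ≤ n → n ≤ k →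
        PlaqC1SmallOn (plaqInside (s.Ω n)) (B₃' * (cR * epsOfRecord ν S.flow.g n) * (F.P K).eta n ^ 3) (UbgMSOfRecord F N ν M S.flow.g K k s W)) :
    ∀ j, 1 ≤ j → j ≤ k → ∀ X : (Sect2.domSys (F.P K) M j).Dom,
      (Sect2.domSites (F.P K) M j X ⊆ s.Λ j →
        Sect2.ofBackgroundC S.ι (UbgMSOfRecord F N ν M S.flow.g K k s W) ∈
          Sect2.spaceI S (Sect2.Residual.unit (F.P K) (MatA N)) M j (Sect2.domSites (F.P K) M j X) (S.lf.alpha0 (S.flow.g j)) (S.lf.alpha1 (S.flow.g j))) ∧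
      (Sect2.admB (F.P K) ν M S.flow.g s.Ω s.Λ j (Sect2.domSites (F.P K) M j X) = true →
        Sect2.ofBackgroundC S.ι (UbgMSOfRecord F N ν M S.flow.g K k s W) ∈
          Sect2.spaceMS S (Sect2.Residual.unit (F.P K) (MatA N)) M j (Sect2.domSites (F.P K) M j X) s.Ω) :=
  bgRowAtDatum_of_classBoundsC1 S hι h𝓜 hS hpos ν hM K k (fun n hn => mul_nonneg hB₃ (hnum n hn).1.le) (fun n hn => mul_nonneg hB₃' (hnum n hn).1.le) s W
    (fun hsol => plaqSmallOn_UbgMSOfRecord_of_thm1RegSepOuter h15 ν M S.flow.g K k cR s hsep hnum ha₀ hcomp h7 hsol)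
    hclassC1 hα hBα hsN hcB hBCM hsmallI hsmallMS hC1 hC2
    (hletterI_of_numerics S.lf ν M hg hpq (fun j hj => ⟨(hnum j hj).1, (hnum j hj).2.1⟩) hΛI0 hΛI htI (fun j h1 hj => (hα j h1 hj).1))
    (hletterMS_of_numerics S.lf ν M hg hpq (fun n hn => ⟨(hnum n hn).1, (hnum n hn).2.1⟩) hΛMS0 hΛMS htMS (fun n h1 hn => (hα n h1 hn).1))

end NamedFactOuter

/-! ## §7 (v1.3, append-only)  PRINT'S (7), THE CONCORD RANGE (HYP-AUDIT-13: dag-ref-G CORRECTION l.17312 + CONCORD l.17323, dag-ref-C LOCATED-P11-LEVEL0 l.17306, dag-n07-e (M3)):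
at every level the plaquettes TOUCHING `Γ_n` that have NO BOND INSIDE `Ω_{n+1}` — `DataSmall7P`, the named fact over it -/

section Printed

variable {P : Params} {G : Type*} [GaugeGroup G]

/-- **NO BOND INSIDE THE DEEPER REGION**: the level-`n` plaquettes none of whose four bonds has BOTH endpoints in `pts n (Ω (n+1))`.  Print ([15] p.278) defines `(∂V)(p′)` on the bonds
of `Λ_n` (an endpoint in `Γ_n`) by `V` and on bonds with both ends in the FINER region by `V̄`; a bond with both ends in `Ω_{n+1}` carries no datum and (7) says nothing there — so exactly these
plaquettes are excluded (dag-ref-G CORRECTION: «the print-UNDEFINED plaquettes of (7)∕(2.10) are those of Λ_j with a BOND inside Ω_{j+1}»).  A plaquette with ONE corner in `Ω_{n+1}` is KEPT (all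
its bonds touch `Γ_n` under separation — at level 0 these are ref-C's pure-data 3-corner plaquettes). [cite: Balaban1985Variational, (7) p.278 L20–33; Balaban1985RegularSpaces, (1.5) p.77] -/
def Sect2.plaqNoBondIn (Ω : ℕ → Set (Site P 0)) (n : ℕ) : Set (Plaq P n) :=
  {p | ¬ (p.src ∈ pts n (Ω (n + 1)) ∧ p.src.shift p.μ ∈ pts n (Ω (n + 1))) ∧
       ¬ (p.src.shift p.μ ∈ pts n (Ω (n + 1)) ∧ (p.src.shift p.μ).shift p.ν ∈ pts n (Ω (n + 1))) ∧
       ¬ (p.src.shift p.ν ∈ pts n (Ω (n + 1)) ∧ (p.src.shift p.μ).shift p.ν ∈ pts n (Ω (n + 1))) ∧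
       ¬ (p.src ∈ pts n (Ω (n + 1)) ∧ p.src.shift p.ν ∈ pts n (Ω (n + 1)))}

/-- **PRINT'S (7) PLAQUETTES AT LEVEL `n`** (the CONCORD range): touching `Γ_n` and with no bond inside `Ω_{n+1}`. [cite: Balaban1985Variational, (7) p.278 L20–33] -/
def Sect2.printedPlaqs (Ω : ℕ → Set (Site P 0)) (k n : ℕ) : Set (Plaq P n) :=
  B8Eq17ClassAkV1.plaqsOf (genSet Ω k n) ∩ Sect2.plaqNoBondIn Ω n

/-- The (7) plaquettes touch `Γ_n`. [cite: Balaban1985Variational, (7) p.278 (bookkeeping)] -/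
theorem Sect2.printedPlaqs_subset_plaqsOf (Ω : ℕ → Set (Site P 0)) (k n : ℕ) : Sect2.printedPlaqs Ω k n ⊆ B8Eq17ClassAkV1.plaqsOf (genSet Ω k n) :=
  Set.inter_subset_left

/-- The §6 outer plaquettes (no CORNER in `Ω_{n+1}`) are (7) plaquettes (no BOND in `Ω_{n+1}`). [cite: Balaban1985Variational, (7) p.278 (bookkeeping)] -/
theorem Sect2.outerPlaqs_subset_printedPlaqs (Ω : ℕ → Set (Site P 0)) (k n : ℕ) : Sect2.outerPlaqs Ω k n ⊆ Sect2.printedPlaqs Ω k n := by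
  rintro p ⟨hp, h1, h2, h3, _⟩
  exact ⟨hp, fun h => h1 h.1, fun h => h2 h.1, fun h => h3 h.1, fun h => h1 h.1⟩

/-- **PRINT'S DATA HYPOTHESIS (7) ON ITS PRINTED RANGE** («|(∂V)(p′) − 1| < ε₁ for p′ ∈ 𝔅», thresholds `δ_n`): level 0 — `W 0` on `printedPlaqs Ω k 0` (every plaquette touching `Γ₀` without
a bond inside `Ω₁`: the 4- and 3-corner and the diagonal 2-corner ones — all of whose bonds are pinned data); level `m+1 ≤ k` — the (7) field `mixedField` (= `spliceAt … (W (m+1)) ((av m).avg (W m))`)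
on `printedPlaqs Ω k (m+1)`.  This is the range the three audit seats agree is print's (ref-G∕ref-C∕n07-e); `DataSmall7` (§1) mis-cuts level 0 (`plaqInside`) and over-reaches at levels ≥ 1
(bonds inside `Ω_{m+2}`), `DataSmall7Outer` (§6) under-reaches (drops one-inner-corner plaquettes); `DataSmall7P → DataSmall7Outer`.
-- TODO(general form): (7) for an arbitrary admissible `𝔅_k` of [6] Sect. A; here `𝔅_k = genSet Ω k` of a (2.18) index.
[cite: Balaban1985Variational, (7) p.278 L20–33; Balaban1985RegularSpaces, (1.3)–(1.9) p.77; Balaban1988Convergent, (2.10)–(2.12) p.256] -/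
def Sect2.DataSmall7P (av : ∀ j, Averaging P j G) (Ω : ℕ → Set (Site P 0)) (k : ℕ) (δ : ℕ → ℝ) (W : MSField P G) : Prop :=
  PlaqSmallOn (Sect2.printedPlaqs Ω k 0) (δ 0) (W 0) ∧
    ∀ m, m + 1 ≤ k → PlaqSmallOn (Sect2.printedPlaqs Ω k (m + 1)) (δ (m + 1)) (Sect2.mixedField av (genSet Ω k (m + 1)) (W (m + 1)) (W m))

/-- (7) on the printed range implies the §6 outer-range clause. [cite: Balaban1985Variational, (7) p.278 (bookkeeping)] -/
theorem Sect2.DataSmall7P.toOuter {av : ∀ j, Averaging P j G} {Ω : ℕ → Set (Site P 0)} {k : ℕ} {δ : ℕ → ℝ} {W : MSField P G} (h : Sect2.DataSmall7P av Ω k δ W) :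
    Sect2.DataSmall7Outer av Ω k δ W :=
  ⟨fun p hp => h.1 p (Sect2.outerPlaqs_subset_printedPlaqs Ω k 0 hp), fun m hm p hp => h.2 m hm p (Sect2.outerPlaqs_subset_printedPlaqs Ω k (m + 1) hp)⟩

/-- The level-`(m+1)` clause in the `spliceAt` spelling. [cite: Balaban1985Variational, (7) p.278 (bookkeeping)] -/
theorem Sect2.DataSmall7P.succ {av : ∀ j, Averaging P j G} {Ω : ℕ → Set (Site P 0)} {k : ℕ} {δ : ℕ → ℝ} {W : MSField P G} (h : Sect2.DataSmall7P av Ω k δ W) {m : ℕ} (hm : m + 1 ≤ k) :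
    PlaqSmallOn (Sect2.printedPlaqs Ω k (m + 1)) (δ (m + 1)) (spliceAt (genSet Ω k (m + 1)) (W (m + 1)) ((av m).avg (W m))) := h.2 m hm

/-- (7) on the printed range FROM ITS TWO CLAUSES (`spliceAt` spelling). [cite: Balaban1985Variational, (7) p.278 (bookkeeping)] -/
theorem Sect2.DataSmall7P.of_spliceAt {av : ∀ j, Averaging P j G} {Ω : ℕ → Set (Site P 0)} {k : ℕ} {δ : ℕ → ℝ} {W : MSField P G}
    (h0 : PlaqSmallOn (Sect2.printedPlaqs Ω k 0) (δ 0) (W 0))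
    (hsucc : ∀ m, m + 1 ≤ k → PlaqSmallOn (Sect2.printedPlaqs Ω k (m + 1)) (δ (m + 1)) (spliceAt (genSet Ω k (m + 1)) (W (m + 1)) ((av m).avg (W m)))) :
    Sect2.DataSmall7P av Ω k δ W := ⟨h0, hsucc⟩

/-- Weakening the thresholds. [cite: Balaban1985Variational, (7) p.278 (bookkeeping)] -/
theorem Sect2.DataSmall7P.of_le {av : ∀ j, Averaging P j G} {Ω : ℕ → Set (Site P 0)} {k : ℕ} {δ δ' : ℕ → ℝ} {W : MSField P G} (h : Sect2.DataSmall7P av Ω k δ W)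
    (hδ : ∀ n, n ≤ k → δ n ≤ δ' n) : Sect2.DataSmall7P av Ω k δ' W :=
  ⟨fun p hp => (h.1 p hp).trans_le (hδ 0 (Nat.zero_le _)), fun m hm p hp => (h.2 m hm p hp).trans_le (hδ (m + 1) hm)⟩

/-- The same-scale support clause (def-R's `regSuppOfRecord` shape: `W n` on ALL plaquettes touching `Γ_n`) gives the level-0 printed clause (fewer plaquettes, same field). [cite: Balaban1988Convergent, (2.10) p.256 (bookkeeping)] -/
theorem Sect2.plaqSmallOn_printedPlaqs_zero_of_plaqsOf {Ω : ℕ → Set (Site P 0)} {k : ℕ} {δ : ℝ} {W0 : GaugeField P 0 G}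
    (h : PlaqSmallOn (B8Eq17ClassAkV1.plaqsOf (genSet Ω k 0)) δ W0) : PlaqSmallOn (Sect2.printedPlaqs Ω k 0) δ W0 :=
  fun p hp => h p hp.1

end Printed

section NamedFactPrinted

variable (F : T4Family) (N : ℕ) [NeZero N]

/-- **★★ [15] THEOREM 1, (R), per scale, print's sequences, PRINT'S DATA (7) ON ITS PRINTED RANGE** — `VariationalThm1RegSepOuter` (§6) with the data hypothesis `Sect2.DataSmall7P` (the
CONCORD range of HYP-AUDIT-13: plaquettes touching `Γ_n` with no bond inside `Ω_{n+1}`, the one-inner-corner plaquettes INCLUDED — at level 0 they are pinned data whose omission made §2∕§6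
print-stronger, dag-ref-C LOCATED-P11-LEVEL0).  A WEAKER statement than §6's (it follows from it: `VariationalThm1RegSepOuter.toPrinted`), and the print-faithful one.  Separated `s`
(record: R = L; print R ≥ R₁ — located letter), thresholds `0 < δ_n ≤ a₁`, `B₃δ_n ≤ ε₀ ≤ a₀`, comparable; conclusion for EVERY minimiser over the class of threshold `ε₀` (record's class =
[6] (1.7) only; print's (6)∕(8) also carry the co-divergence member (1.9) — located, logged): `|U₀(∂p) − 1| < B₃δ_n·η_n²` on the plaquettes meeting `Ω_n(s)`; floor `2L² ≤ B₃` displayed by consumers.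
NEVER asserted; constants as parameters.
-- TODO(general form): ONE threshold ε₁ in print; general admissible `{Ω_j}`∕`𝔅_k`; print's class (6)∕(8) carries (1.9).
[cite: Balaban1985Variational, Thm 1 (2),(7)–(8) pp.278–279; Balaban1985RegularSpaces, (1.3)–(1.9) p.77; Balaban1988Convergent, (2.7)–(2.8) pp.255–256, (2.12) p.256, p.259] -/
def VariationalThm1RegSepPrinted (B₃ a₀ a₁ : ℝ) : Prop :=
  ∀ (ν : Stage7Numerics) (M : ℕ) (g : ℕ → ℝ) (K k : ℕ) (s : SeqOfRecord F ν M g K k), Sect2.SeqSeparated ν.M₁ s → ∀ (ε₀ : ℝ) (δ : ℕ → ℝ),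
    (∀ n, n ≤ k → 0 < δ n ∧ δ n ≤ a₁ ∧ B₃ * δ n ≤ ε₀) → (∀ n, n < k → δ n ≤ 2 * δ (n + 1)) → ε₀ ≤ a₀ →
    ∀ W : MSField (F.P K) (SU N), Sect2.DataSmall7P (avOfRecord F N K) s.Ω k δ W →
      ∀ U₀, IsMinimizer (avOfRecord F N K) {U | ∀ n, n ≤ k → PlaqSmallOn (omegaPlaqs s.Ω n) (ε₀ * (F.P K).eta n ^ 2) U} (genSet s.Ω k) W U₀ →
        ∀ n, n ≤ k → PlaqSmallOn (omegaPlaqs s.Ω n) (B₃ * δ n * (F.P K).eta n ^ 2) U₀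

variable {F N}

/-- The §6 fact (weaker data hypothesis) implies the printed-range fact. [cite: Balaban1985Variational, Thm 1 (7)–(8) pp.278–279 (bookkeeping)] -/
theorem VariationalThm1RegSepOuter.toPrinted {B₃ a₀ a₁ : ℝ} (h : VariationalThm1RegSepOuter F N B₃ a₀ a₁) : VariationalThm1RegSepPrinted F N B₃ a₀ a₁ :=
  fun ν M g K k s hsep ε₀ δ hδ hcomp hε₀ W h7 => h ν M g K k s hsep ε₀ δ hδ hcomp hε₀ W h7.toOuter

/-- **★ DEF-R'S BACKGROUND IS `B₃·cR·ε_n`-REGULAR AT EVERY SCALE FOR A DATUM SATISFYING PRINT'S (7) ON ITS PRINTED RANGE** (separated sequence, comparable thresholds, solvable fibre).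
[cite: Balaban1985Variational, Thm 1 (7)–(8) pp.278–279; Balaban1988Convergent, (2.7)–(2.8) pp.255–256, (2.12) p.256, p.259] -/
theorem plaqSmallOn_UbgMSOfRecord_of_thm1RegSepPrinted {B₃ a₀ a₁ : ℝ} (h15 : VariationalThm1RegSepPrinted F N B₃ a₀ a₁) (ν : Stage7Numerics) (M : ℕ)
    (g : ℕ → ℝ) (K k : ℕ) (cR : ℝ) (s : SeqOfRecord F ν M g K k) (hsep : Sect2.SeqSeparated ν.M₁ s)
    (hnum : ∀ n, n ≤ k → 0 < cR * epsOfRecord ν g n ∧ cR * epsOfRecord ν g n ≤ a₁ ∧ B₃ * (cR * epsOfRecord ν g n) ≤ ν.εreg) (ha₀ : ν.εreg ≤ a₀)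
    (hcomp : ∀ n, n < k → cR * epsOfRecord ν g n ≤ 2 * (cR * epsOfRecord ν g (n + 1)))
    {W : MSField (F.P K) (SU N)} (h7 : Sect2.DataSmall7P (avOfRecord F N K) s.Ω k (fun n => cR * epsOfRecord ν g n) W)
    (hsol : W ∈ solvableDom (avOfRecord F N K) (regMSOfRecord F N ν K k s.Ω) (genSet s.Ω k)) :
    ∀ n, n ≤ k → PlaqSmallOn (omegaPlaqs s.Ω n) (B₃ * (cR * epsOfRecord ν g n) * (F.P K).eta n ^ 2) (UbgMSOfRecord F N ν M g K k s W) :=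
  h15 ν M g K k s hsep ν.εreg (fun n => cR * epsOfRecord ν g n) hnum hcomp ha₀ W h7 _ (isMinimizer_UbgMSOfRecord ν M g K k s hsol)

/-- **★★★ ROW P11's BODY AT `(s, 𝐖)` FROM THE PRINTED-RANGE FACT** — `bgRowAtDatum_of_classBoundsC1` fed by `VariationalThm1RegSepPrinted` + `h7 : Sect2.DataSmall7P … W` (the support
guard of record, v1.3) + the displayed C¹ class clause + FILE 7c's numerics letters. [cite: Balaban1985Variational, Thm 1 (7)–(10) pp.278–279; Balaban1985RegularSpaces, (1.3)–(1.9) p.77; Balaban1988Convergent, (2.4)–(2.8) pp.255–256, (2.27)–(2.28) p.259, (2.34)–(2.41) p.261; Balaban1987RG1, (1.11)–(1.16) p.262] -/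
theorem bgRowAtDatum_of_thm1RegSepPrintedC1 {B₃ B₃' a₀ a₁ tI tMS : ℝ} (h15 : VariationalThm1RegSepPrinted F N B₃ a₀ a₁)
    (S : Sect2.Setting (MatA N) (SU N)) (hι : S.ι = ιSU N) (h𝓜 : S.𝓜 = B12RegularSpaces111SpecialUnitary.suModel N) (hS : S.Laws) (hpos : S.Pos)
    (ν : Stage7Numerics) {M : ℕ} (hM : 0 < M) (K k : ℕ) (cR : ℝ) (hB₃ : 0 ≤ B₃) (hB₃' : 0 ≤ B₃')
    (hg : ∀ j, 1 ≤ j → j ≤ k → 0 < S.flow.g j ∧ S.flow.g j ^ 2 ≤ Real.exp (-1)) (hpq : ν.p₀ ≤ S.lf.q₀)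
    (hnum : ∀ n, n ≤ k → 0 < cR * epsOfRecord ν S.flow.g n ∧ cR * epsOfRecord ν S.flow.g n ≤ a₁ ∧ B₃ * (cR * epsOfRecord ν S.flow.g n) ≤ ν.εreg)
    (ha₀ : ν.εreg ≤ a₀) (hcomp : ∀ n, n < k → cR * epsOfRecord ν S.flow.g n ≤ 2 * (cR * epsOfRecord ν S.flow.g (n + 1)))
    (hα : ∀ n, 1 ≤ n → n ≤ k → 0 < S.lf.alpha0 (S.flow.g n) ∧ 0 < S.lf.alpha1 (S.flow.g n))
    (hBα : ∀ n, 1 ≤ n → n ≤ k → B₃ * (cR * epsOfRecord ν S.flow.g n) ≤ (1 - S.βc) * S.lf.alpha0 (S.flow.g n))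
    (hΛI0 : 0 ≤ (4 * (B₃ + (((F.P K).d - 1 : ℕ) : ℝ) * (((F.P K).L : ℝ) * M) * B₃') + 16 * ((((F.P K).d - 1 : ℕ) : ℝ) * (((F.P K).L : ℝ) * M)) ^ 2 * B₃ ^ 2 * a₁) * cR * ν.A₀)
    (hΛI : (4 * (B₃ + (((F.P K).d - 1 : ℕ) : ℝ) * (((F.P K).L : ℝ) * M) * B₃') + 16 * ((((F.P K).d - 1 : ℕ) : ℝ) * (((F.P K).L : ℝ) * M)) ^ 2 * B₃ ^ 2 * a₁) * cR * ν.A₀ ≤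
      tI * S.lf.C₀) (htI : tI < S.cB)
    (hΛMS0 : 0 ≤ (4 * (B₃ + (((F.P K).d - 1 : ℕ) : ℝ) * (M : ℝ) * B₃') + 16 * ((((F.P K).d - 1 : ℕ) : ℝ) * (M : ℝ)) ^ 2 * B₃ ^ 2 * a₁) * cR * ν.A₀)
    (hΛMS : (4 * (B₃ + (((F.P K).d - 1 : ℕ) : ℝ) * (M : ℝ) * B₃') + 16 * ((((F.P K).d - 1 : ℕ) : ℝ) * (M : ℝ)) ^ 2 * B₃ ^ 2 * a₁) * cR * ν.A₀ ≤ tMS * S.lf.C₀)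
    (htMS : tMS < S.B * S.C * S.Mr)
    (hsN : ∀ n, 1 ≤ n → n ≤ k + 1 → ((B14.Eq213MaximalDomains.side (F.P K).L M n : ℕ) : ℤ) < (F.P K).sitesPerDir 0)
    (hcB : 2 * (((F.P K).d - 1 : ℕ) : ℝ) * ((F.P K).L * M) < S.cB) (hBCM : 2 * (((F.P K).d - 1 : ℕ) : ℝ) * M < S.B * S.C * S.Mr)
    (hsmallI : ∀ j, 1 ≤ j → j ≤ k → (((F.P K).d - 1 : ℕ) : ℝ) * ((F.P K).L * M) * (F.P K).eta j * (B₃ * (cR * epsOfRecord ν S.flow.g j)) ≤ 1 / 2)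
    (hsmallMS : ∀ n, 1 ≤ n → n ≤ k → (((F.P K).d - 1 : ℕ) : ℝ) * M * (F.P K).eta n * (B₃ * (cR * epsOfRecord ν S.flow.g n)) ≤ 1 / 2)
    (hC1 : ∀ j, 1 ≤ j → j ≤ k → ∃ t : ℕ, 0 < t ∧ RkOfRecord (F.P K).L ν.r (S.flow.g j) = (F.P K).L * t)
    (hC2 : ∀ j, 1 ≤ j → j ≤ k → dCubeSide (F.P K).L M (RkOfRecord (F.P K).L ν.r (S.flow.g j)) j ∣ (F.P K).sitesPerDir 0)
    (s : SeqOfRecord F ν M S.flow.g K k) (hsep : Sect2.SeqSeparated ν.M₁ s) (W : MSField (F.P K) (SU N))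
    (h7 : Sect2.DataSmall7P (avOfRecord F N K) s.Ω k (fun n => cR * epsOfRecord ν S.flow.g n) W)
    (hclassC1 : W ∈ solvableDom (avOfRecord F N K) (regMSOfRecord F N ν K k s.Ω) (genSet s.Ω k) →
      ∀ n, 1 ≤ n → n ≤ k →
        PlaqC1SmallOn (plaqInside (s.Ω n)) (B₃' * (cR * epsOfRecord ν S.flow.g n) * (F.P K).eta n ^ 3) (UbgMSOfRecord F N ν M S.flow.g K k s W)) :
    ∀ j, 1 ≤ j → j ≤ k → ∀ X : (Sect2.domSys (F.P K) M j).Dom,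
      (Sect2.domSites (F.P K) M j X ⊆ s.Λ j →
        Sect2.ofBackgroundC S.ι (UbgMSOfRecord F N ν M S.flow.g K k s W) ∈
          Sect2.spaceI S (Sect2.Residual.unit (F.P K) (MatA N)) M j (Sect2.domSites (F.P K) M j X) (S.lf.alpha0 (S.flow.g j)) (S.lf.alpha1 (S.flow.g j))) ∧
      (Sect2.admB (F.P K) ν M S.flow.g s.Ω s.Λ j (Sect2.domSites (F.P K) M j X) = true →
        Sect2.ofBackgroundC S.ι (UbgMSOfRecord F N ν M S.flow.g K k s W) ∈
          Sect2.spaceMS S (Sect2.Residual.unit (F.P K) (MatA N)) M j (Sect2.domSites (F.P K) M j X) s.Ω) :=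
  bgRowAtDatum_of_classBoundsC1 S hι h𝓜 hS hpos ν hM K k (fun n hn => mul_nonneg hB₃ (hnum n hn).1.le) (fun n hn => mul_nonneg hB₃' (hnum n hn).1.le) s W
    (fun hsol => plaqSmallOn_UbgMSOfRecord_of_thm1RegSepPrinted h15 ν M S.flow.g K k cR s hsep hnum ha₀ hcomp h7 hsol)
    hclassC1 hα hBα hsN hcB hBCM hsmallI hsmallMS hC1 hC2
    (hletterI_of_numerics S.lf ν M hg hpq (fun j hj => ⟨(hnum j hj).1, (hnum j hj).2.1⟩) hΛI0 hΛI htI (fun j h1 hj => (hα j h1 hj).1))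
    (hletterMS_of_numerics S.lf ν M hg hpq (fun n hn => ⟨(hnum n hn).1, (hnum n hn).2.1⟩) hΛMS0 hΛMS htMS (fun n h1 hn => (hα n h1 hn).1))

end NamedFactPrinted

end Literature.MathematicalPhysics.QuantumFieldTheory.Balaban1983to89.Node00

end
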